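import Literature.NumberTheory.Sieve.BombieriFriedlanderIwaniecBilinearProofs
import Literature.NumberTheory.Sieve.BombieriFriedlanderIwaniecCaseTools
import Literature.NumberTheory.Sieve.ShiuBrunTitchmarshProofs
import HarnessLib

/-!
# Bombieri–Friedlander–Iwaniec 1986: Theorem 5* on boxes from the printed Theorem 5*

Topic `Literature/NumberTheory/Sieve`, companion to
`Literature.NumberTheory.Sieve.BombieriFriedlanderIwaniecBilinear` (which vendors the named fact
`Literature.NumberTheory.Sieve.BombieriFriedlanderIwaniecTheorem5StarInterval`, "Theorem 5* as applied
in §15": the coefficients (A₆*) `1_{(m,P(z))=1}` restricted to a box `(M₁, M₂]`) and to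
`Literature.NumberTheory.Sieve.BombieriFriedlanderIwaniecDispersion` (which vendors the PRINTED
Theorem 5*, `Literature.NumberTheory.Sieve.BombieriFriedlanderIwaniecTheorem5Star`, (A₆*) on the whole
range `m ∼ M`).  Everything here is PROVED.  Source: E. Bombieri, J. B. Friedlander, H. Iwaniec,
*Primes in arithmetic progressions to large moduli*, Acta Math. 156 (1986), 203–251, §12 Theorem 5*
(p. 238), §15 (15.4) (p. 244) and p. 246, §17 p. 249.

## Main results

* `Literature.NumberTheory.Sieve.BombieriFriedlanderIwaniecTheorem5Star.interval` — the printed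
  Theorem 5* IMPLIES its boxed form for every sifting range `z ≤ exp(log x / log log x − K)` with some
  `K = K(a, ε, A, B)`: the statement of `…Theorem5StarInterval` verbatim except for the constant `e^{−K}`
  in the admissible range of `z`.
* `Literature.NumberTheory.Sieve.BombieriFriedlanderIwaniecTheorem5Star.intervalSqrt` — the same with
  `z ≤ exp(√log x)`, which is the sifting range (15.4) actually used in §§15–17 (and by
  `Literature.NumberTheory.Sieve.BFI.caseB1_bound`).  Consequently every consumer of the boxed form at
  `z = exp(√log x)` can take the PRINTED Theorem 5* as its hypothesis instead of the applied form
  (`caseB1_bound` applies the boxed form at an auxiliary scale `X' ≥ x` with `z ≤ exp(√log x)`;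
  since `exp(√log x) ≤ exp(√log X')`, `.intervalSqrt` at `X'` is the variant that plugs in there).
* `Literature.NumberTheory.Sieve.BombieriFriedlanderIwaniecTheorem5.interval` — the printed Theorem 5
  (`…Theorem5`, (A₆) `α ≡ 1`, power saving `x^{−ε'}`) IMPLIES its boxed form `α = 1_{(M₁,M₂]}` with a
  power saving `x^{−ε''}`, `ε'' = min(ε', 1/2, ε/48)`: the form in which Theorem 5 is applied to the
  `E_d` on p. 238 (scales `M/d`) — same telescoping, no sifting range to track, depth `2^k ≍ x^{ε/24}`.

## The argument (not in the source; elementary given Theorem 5*)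

Write `𝒟(M,N,Q,R; α) = ∑_{m∼M} α_m F(m)` with the `m`-rows `F` (`BFI.rowF`, `BFI.dispD_eq_sum_rowF`)
and put `g(m) = 1_{(m,P(z))=1} F(m)`.  For a box `(M, P] ⊆ (M, 2M]` the identity
`∑_{(M,P]} g = ∑_{j<k} (∑_{(P/2^{j+1}, P/2^j]} g − ∑_{(M/2^{j+1}, M/2^j]} g) + ∑_{(M/2^k, P/2^k]} g`
(`BFI.boxSum_telescope`) expresses it through FULL dyadic ranges at the smaller scales
`M'' ∈ [M/2^{j+1}, M/2^j]`, each of which is `𝒟(M'', N, Q, R; (A₆*))` at `x'' = M''N = x/t`,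
`t ∈ [2^j, 2^{j+1}]` — where the hypotheses (A₁) (with `ε/2`), (12.5) and `QR < x''` of Theorem 5*
still hold as long as `t³ ≤ x^{ε/2}` (`BFI.thm5_hyp_at_scale`), and `z ≤ z₀(x'')` holds as long as
`z ≤ e^{−K} z₀(x)` (`BFI.exp_div_loglog_sub_le`; this is the only loss) — plus a last box at scale
`M/2^k`.  Theorem 5* bounds the piece at scale `M''` by `≪ ‖β‖ x^{1/2} M^{1/2} ℒ^{−A} 2^{−j}`, which
sums; with `2^k ≍ ℒ^{A+c}` the last box is bounded TRIVIALLY (`BFI.abs_boxSum_rowF_le`): the congruence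
part by BFI Lemma 3 (PROVED in the tree, `Literature.NumberTheory.Sieve.BombieriFriedlanderIwaniecLemma3_holds`)
in the class `0 (mod n)` and Cauchy's inequality in `n`, the `φ⁻¹`-part by
`∑ τ(q)^B/φ(q) ≪ ℒ^c`, giving `≪ ‖β‖ N^{1/2} (M/2^k) ℒ^c ≤ ‖β‖ x^{1/2} M^{1/2} ℒ^{−A}`.

## What is NOT here

The full range `z ≤ z₀(x) = exp(log x/log log x)` of `…Theorem5StarInterval` is not reached: the
scales `x'' < x` admit only `z ≤ z₀(x'')`, and bridging `(e^{−K} z₀(x), z₀(x)]` by Buchstab's identity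
would require bounds for bilinear forms with a sparse second factor, i.e. the power saving of
Theorem 5 (Kloosterman-sum input), which the tree does not have.  So `…Theorem5StarInterval` itself
remains a named fact; this file shows that its USED instance (`z = exp(√log x)`) is a theorem given the
printed Theorem 5*.

## References

* E. Bombieri, J. B. Friedlander, H. Iwaniec, *Primes in arithmetic progressions to large moduli*,
  Acta Math. 156 (1986), 203–251: §2 Lemma 3 p. 211; §3 (3.1) p. 214; §12 (12.1) p. 236, (12.5) and
  Theorem 5 p. 237, Theorem 5* p. 238; §15 (15.4) p. 244, p. 246; §17 p. 249.
  [BombieriFriedlanderIwaniecActa1986]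
-/

open Finset Real
open scoped ArithmeticFunction.sigma

namespace Literature.NumberTheory.Sieve

namespace BFI

/-! ### The `m`-rows of `𝒟` -/

/-- The `m`-summand of `𝒟(M,N,Q,R)` (BFI (3.1), p. 214) before weighting by `α_m`:
`F(m) = ∑_{q∼Q, r∼R, (qr,a)=1} γ_q δ_r (∑_{n∼N, mn≡a (qr)} β_n − φ(qr)⁻¹ ∑_{n∼N, (mn,qr)=1} β_n)`,
so that `𝒟 = ∑_{m∼M} α_m F(m)` (`dispD_eq_sum_rowF`). [cite: BombieriFriedlanderIwaniecActa1986, §3 (3.1) p. 214] -/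
noncomputable def rowF (a : ℤ) (N Q R : ℝ) (β γ δ : ℕ → ℝ) (m : ℕ) : ℝ :=
  ∑ q ∈ dyadic Q, ∑ r ∈ dyadic R,
    if IsCoprime ((q * r : ℕ) : ℤ) a then
      γ q * δ r *
        ((∑ n ∈ dyadic N, if ((m * n : ℕ) : ZMod (q * r)) = (a : ZMod (q * r)) then β n else 0) -
          (∑ n ∈ dyadic N, if (m * n).Coprime (q * r) then β n else 0) / (Nat.totient (q * r) : ℝ))
    else 0

/-- `𝒟(M,N,Q,R; α,β,γ,δ) = ∑_{m∼M} α_m F(m)`: `𝒟` is a weighted sum of its `m`-rows. [folklore] -/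
theorem dispD_eq_sum_rowF (a : ℤ) (M N Q R : ℝ) (α β γ δ : ℕ → ℝ) :
    dispD a M N Q R α β γ δ = ∑ m ∈ dyadic M, α m * rowF a N Q R β γ δ m := by
  have hin : ∀ (P : ℕ → ℕ → Prop) [∀ m n, Decidable (P m n)],
      (∑ m ∈ dyadic M, ∑ n ∈ dyadic N, if P m n then α m * β n else 0) =
        ∑ m ∈ dyadic M, α m * ∑ n ∈ dyadic N, if P m n then β n else 0 := by
    intro P _
    refine Finset.sum_congr rfl fun m _ => ?_
    rw [Finset.mul_sum]
    exact Finset.sum_congr rfl fun n _ => by split_ifs <;> simp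
  unfold dispD rowF
  simp_rw [hin]
  rw [show (∑ m ∈ dyadic M, α m * ∑ q ∈ dyadic Q, ∑ r ∈ dyadic R,
      (if IsCoprime ((q * r : ℕ) : ℤ) a then
        γ q * δ r *
          ((∑ n ∈ dyadic N, if ((m * n : ℕ) : ZMod (q * r)) = (a : ZMod (q * r)) then β n else 0) -
            (∑ n ∈ dyadic N, if (m * n).Coprime (q * r) then β n else 0) / (Nat.totient (q * r) : ℝ))
      else 0)) =
      ∑ q ∈ dyadic Q, ∑ r ∈ dyadic R, ∑ m ∈ dyadic M, α m *
      (if IsCoprime ((q * r : ℕ) : ℤ) a then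
        γ q * δ r *
          ((∑ n ∈ dyadic N, if ((m * n : ℕ) : ZMod (q * r)) = (a : ZMod (q * r)) then β n else 0) -
            (∑ n ∈ dyadic N, if (m * n).Coprime (q * r) then β n else 0) / (Nat.totient (q * r) : ℝ))
      else 0) by
    simp_rw [Finset.mul_sum]
    rw [Finset.sum_comm]
    exact Finset.sum_congr rfl fun q _ => Finset.sum_comm]
  refine Finset.sum_congr rfl fun q _ => Finset.sum_congr rfl fun r _ => ?_
  split_ifs with hqr
  · rw [Finset.sum_div, ← Finset.sum_sub_distrib, Finset.mul_sum]
    exact Finset.sum_congr rfl fun m _ => by ring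
  · simp

/-! ### Sums of a fixed function over real boxes `(u, v]` -/

/-- `∑_{u < m ≤ v} g(m)` over the integers of the real box `(u, v]` (for `u, v ≥ 0`). [folklore] -/
noncomputable def boxSum (g : ℕ → ℝ) (u v : ℝ) : ℝ :=
  ∑ m ∈ Ioc ⌊u⌋₊ ⌊v⌋₊, g m

/-- Additivity of box sums: `∑_{(u,v]} + ∑_{(v,w]} = ∑_{(u,w]}` for `u ≤ v ≤ w`. [folklore] -/
theorem boxSum_add (g : ℕ → ℝ) {u v w : ℝ} (huv : u ≤ v) (hvw : v ≤ w) :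
    boxSum g u v + boxSum g v w = boxSum g u w :=
  Finset.sum_Ioc_consecutive _ (Nat.floor_le_floor huv) (Nat.floor_le_floor hvw)

/-- **Downward dyadic telescoping of a box.**  For `0 ≤ M ≤ P ≤ 2M` and every `k`,
`∑_{(M,P]} g = ∑_{j<k} (∑_{(P/2^{j+1}, P/2^j]} g − ∑_{(M/2^{j+1}, M/2^j]} g) + ∑_{(M/2^k, P/2^k]} g`:
each bracket is a difference of two sums over full dyadic ranges `(M'', 2M'']` at the scales
`M'' = P/2^{j+1}, M/2^{j+1}`, and the last box lies at scale `M/2^k`. [folklore] -/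
theorem boxSum_telescope (g : ℕ → ℝ) {M P : ℝ} (hM : 0 ≤ M) (hMP : M ≤ P) (hP : P ≤ 2 * M) (k : ℕ) :
    boxSum g M P = (∑ j ∈ Finset.range k,
        (boxSum g (P / 2 ^ (j + 1)) (P / 2 ^ j) - boxSum g (M / 2 ^ (j + 1)) (M / 2 ^ j))) +
      boxSum g (M / 2 ^ k) (P / 2 ^ k) := by
  induction k with
  | zero => simp
  | succ k ih =>
    rw [Finset.sum_range_succ, ih]
    -- one step at scale `M/2^k ≤ P/2^k ≤ 2M/2^k`
    have h2k : (0 : ℝ) < 2 ^ k := by positivity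
    have hMk : 0 ≤ M / 2 ^ k := by positivity
    have e1 : M / 2 ^ (k + 1) = M / 2 ^ k / 2 := by rw [pow_succ]; ring
    have e2 : P / 2 ^ (k + 1) = P / 2 ^ k / 2 := by rw [pow_succ]; ring
    rw [e1, e2]
    set Mk := M / 2 ^ k
    set Pk := P / 2 ^ k
    have hMPk : Mk ≤ Pk := div_le_div_of_nonneg_right hMP h2k.le
    have hPMk : Pk ≤ 2 * Mk := by
      show P / 2 ^ k ≤ 2 * (M / 2 ^ k)
      rw [mul_div_assoc']; exact div_le_div_of_nonneg_right hP h2k.le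
    have hA := boxSum_add g (show Mk / 2 ≤ Mk by linarith) hMPk
    have hB := boxSum_add g (show Mk / 2 ≤ Pk / 2 by linarith) (show Pk / 2 ≤ Pk by linarith [hMk])
    linarith

/-! ### `𝒟` with (boxed) rough coefficients as box sums -/

/-- `𝒟(M''; 1_{(·,P(z))=1}) = ∑_{(M'', 2M'']} 1_{(m,P(z))=1} F(m)`. [folklore] -/
theorem dispD_rough_eq_boxSum (a : ℤ) {M : ℝ} (hM : 0 ≤ M) (N Q R z : ℝ) (β γ δ : ℕ → ℝ) :
    dispD a M N Q R (roughIndicator z) β γ δ =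
      boxSum (fun m => roughIndicator z m * rowF a N Q R β γ δ m) M (2 * M) := by
  rw [dispD_eq_sum_rowF, boxSum, dyadic_eq_Ioc hM]

/-- `𝒟(M; 1_{(u,v]} · 1_{(·,P(z))=1}) = ∑_{(u,v]} 1_{(m,P(z))=1} F(m)` for `M ≤ u ≤ v ≤ 2M`. [folklore] -/
theorem dispD_box_eq_boxSum (a : ℤ) {M u v : ℝ} (hM : 0 ≤ M) (hMu : M ≤ u) (huv : u ≤ v)
    (hv : v ≤ 2 * M) (N Q R z : ℝ) (β γ δ : ℕ → ℝ) :
    dispD a M N Q R (fun m => if u < (m : ℝ) ∧ (m : ℝ) ≤ v then roughIndicator z m else 0) β γ δ =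
      boxSum (fun m => roughIndicator z m * rowF a N Q R β γ δ m) u v := by
  rw [dispD_eq_sum_rowF, boxSum, dyadic_eq_Ioc hM]
  simp_rw [ite_mul, zero_mul]
  rw [← Finset.sum_filter]
  refine Finset.sum_congr ?_ fun _ _ => rfl
  ext m
  rw [Finset.mem_filter, Finset.mem_Ioc, Finset.mem_Ioc, Nat.floor_lt hM,
    Nat.le_floor_iff (by linarith), Nat.floor_lt (hM.trans hMu), Nat.le_floor_iff (hM.trans (hMu.trans huv))]
  constructor
  · rintro ⟨-, h⟩; exact h
  · rintro ⟨h1, h2⟩; exact ⟨⟨lt_of_le_of_lt hMu h1, h2.trans hv⟩, h1, h2⟩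

/-- Clamping a general box to the dyadic range: on `m ∼ M` (`M ≥ 0`),
`1_{(M₁,M₂]} · ρ = 1_{(u,v]} · ρ` with `u = max M (min M₁ 2M)`, `v = max u (min M₂ 2M)`, so that
`M ≤ u ≤ v ≤ 2M`. [folklore] -/
theorem dispD_box_clamp (a : ℤ) {M : ℝ} (hM : 0 ≤ M) (M₁ M₂ N Q R : ℝ) (ρ β γ δ : ℕ → ℝ) :
    dispD a M N Q R (fun m => if M₁ < (m : ℝ) ∧ (m : ℝ) ≤ M₂ then ρ m else 0) β γ δ =
      dispD a M N Q R (fun m => if max M (min M₁ (2 * M)) < (m : ℝ) ∧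
        (m : ℝ) ≤ max (max M (min M₁ (2 * M))) (min M₂ (2 * M)) then ρ m else 0) β γ δ := by
  refine dispD_congr_alpha N Q R (fun m hm => ?_) β γ δ
  obtain ⟨h1, h2⟩ := (mem_dyadic hM).1 hm
  have hiff : (M₁ < (m : ℝ) ∧ (m : ℝ) ≤ M₂) ↔ (max M (min M₁ (2 * M)) < (m : ℝ) ∧
      (m : ℝ) ≤ max (max M (min M₁ (2 * M))) (min M₂ (2 * M))) := by
    constructor
    · rintro ⟨h3, h4⟩
      refine ⟨max_lt h1 (lt_of_le_of_lt (min_le_left _ _) h3), ?_⟩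
      exact le_trans (le_min h4 h2) (le_max_right _ _)
    · rintro ⟨h3, h4⟩
      have hM₁ : M₁ < (m : ℝ) := by
        rcases le_total M₁ (2 * M) with h5 | h5
        · have h6 : M₁ ≤ max M (min M₁ (2 * M)) := by rw [min_eq_left h5]; exact le_max_right _ _
          exact lt_of_le_of_lt h6 h3
        · have h6 : 2 * M ≤ max M (min M₁ (2 * M)) := by rw [min_eq_right h5]; exact le_max_right _ _
          linarith [lt_of_le_of_lt h6 h3]
      refine ⟨hM₁, ?_⟩
      rcases le_total (max M (min M₁ (2 * M))) (min M₂ (2 * M)) with h5 | h5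
      · rw [max_eq_right h5] at h4; exact h4.trans (min_le_left _ _)
      · rw [max_eq_left h5] at h4; exact absurd (lt_of_lt_of_le h3 h4) (lt_irrefl _)
  by_cases h : M₁ < (m : ℝ) ∧ (m : ℝ) ≤ M₂
  · rw [if_pos h, if_pos (hiff.1 h)]
  · rw [if_neg h, if_neg (fun h' => h (hiff.2 h'))]

/-- The clamped endpoints satisfy `M ≤ u ≤ v ≤ 2M` (`M ≥ 0`). [folklore] -/
theorem clamp_bounds {M : ℝ} (hM : 0 ≤ M) (M₁ M₂ : ℝ) :
    M ≤ max M (min M₁ (2 * M)) ∧ max M (min M₁ (2 * M)) ≤ max (max M (min M₁ (2 * M))) (min M₂ (2 * M)) ∧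
      max (max M (min M₁ (2 * M))) (min M₂ (2 * M)) ≤ 2 * M :=
  ⟨le_max_left _ _, le_max_left _ _,
    max_le (max_le (by linarith) (min_le_right _ _)) (min_le_right _ _)⟩

/-! ### The trivial bound for the rows -/

/-- Pointwise bound for a row:
`|F(m)| ≤ ∑_{q∼Q, r∼R} |γ_q| |δ_r| (∑_{n∼N, mn≡a (qr)} |β_n| + φ(qr)⁻¹ ∑_{n∼N} |β_n|)`. [folklore] -/
theorem abs_rowF_le (a : ℤ) (N Q R : ℝ) (β γ δ : ℕ → ℝ) (m : ℕ) :
    |rowF a N Q R β γ δ m| ≤ ∑ q ∈ dyadic Q, ∑ r ∈ dyadic R, |γ q| * |δ r| *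
      ((∑ n ∈ dyadic N, if ((m * n : ℕ) : ZMod (q * r)) = (a : ZMod (q * r)) then |β n| else 0) +
        (∑ n ∈ dyadic N, |β n|) / (Nat.totient (q * r) : ℝ)) := by
  unfold rowF
  refine (Finset.abs_sum_le_sum_abs _ _).trans (Finset.sum_le_sum fun q _ => ?_)
  refine (Finset.abs_sum_le_sum_abs _ _).trans (Finset.sum_le_sum fun r _ => ?_)
  have hA : |∑ n ∈ dyadic N, (if ((m * n : ℕ) : ZMod (q * r)) = (a : ZMod (q * r)) then β n else 0)| ≤
      ∑ n ∈ dyadic N, (if ((m * n : ℕ) : ZMod (q * r)) = (a : ZMod (q * r)) then |β n| else 0) :=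
    (Finset.abs_sum_le_sum_abs _ _).trans (Finset.sum_le_sum fun n _ => by split_ifs <;> simp)
  have hB : |∑ n ∈ dyadic N, (if (m * n).Coprime (q * r) then β n else 0)| ≤ ∑ n ∈ dyadic N, |β n| :=
    (Finset.abs_sum_le_sum_abs _ _).trans (Finset.sum_le_sum fun n _ => by split_ifs <;> simp)
  have hφ : (0 : ℝ) ≤ (Nat.totient (q * r) : ℝ) := Nat.cast_nonneg _
  split_ifs with hcop
  · rw [abs_mul, abs_mul]
    refine mul_le_mul_of_nonneg_left ?_ (by positivity)
    refine (abs_sub _ _).trans (add_le_add hA ?_)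
    rw [abs_div, abs_of_nonneg hφ]
    exact div_le_div_of_nonneg_right hB hφ
  · rw [abs_zero]; positivity

/-- The divisor count behind the congruence part of the trivial bound: for `w ≥ 1`,
`∑_{q ∈ S, r ∈ T, qr ∣ w} τ(q)^B τ(r)^B ≤ τ(w)^{2B+2}`. [folklore] -/
theorem sum_sum_dvd_sigma_pow_le (S T : Finset ℕ) (B : ℕ) {w : ℕ} (hw : w ≠ 0) :
    ∑ q ∈ S, ∑ r ∈ T, (if ((q * r : ℕ) : ℤ) ∣ (w : ℤ) then (σ 0 q : ℝ) ^ B * (σ 0 r : ℝ) ^ B else 0) ≤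
      (σ 0 w : ℝ) ^ (2 * B + 2) := by
  have hone : ∀ U : Finset ℕ, ∑ q ∈ U, (if q ∣ w then (σ 0 q : ℝ) ^ B else 0) ≤ (σ 0 w : ℝ) ^ (B + 1) := by
    intro U
    rw [← Finset.sum_filter]
    calc ∑ q ∈ U.filter (· ∣ w), (σ 0 q : ℝ) ^ B ≤ ∑ q ∈ w.divisors, (σ 0 q : ℝ) ^ B := by
          refine Finset.sum_le_sum_of_subset_of_nonneg (fun q hq => ?_) fun _ _ _ => by positivity
          rw [Finset.mem_filter] at hq
          exact Nat.mem_divisors.2 ⟨hq.2, hw⟩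
      _ ≤ ∑ q ∈ w.divisors, (σ 0 w : ℝ) ^ B := by
          refine Finset.sum_le_sum fun q hq => ?_
          have h := sigma_zero_le_of_dvd hw (Nat.dvd_of_mem_divisors hq)
          exact_mod_cast pow_le_pow_left' h B
      _ = (σ 0 w : ℝ) ^ (B + 1) := by
          rw [Finset.sum_const, nsmul_eq_mul, pow_succ, mul_comm, ArithmeticFunction.sigma_zero_apply]
  calc ∑ q ∈ S, ∑ r ∈ T, (if ((q * r : ℕ) : ℤ) ∣ (w : ℤ) then (σ 0 q : ℝ) ^ B * (σ 0 r : ℝ) ^ B else 0)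
      ≤ ∑ q ∈ S, ∑ r ∈ T, (if q ∣ w then (σ 0 q : ℝ) ^ B else 0) * (if r ∣ w then (σ 0 r : ℝ) ^ B else 0) := by
        refine Finset.sum_le_sum fun q _ => Finset.sum_le_sum fun r _ => ?_
        split_ifs with h h1 h2 h2
        · exact le_rfl
        · exact absurd ((dvd_mul_left r q).trans (Int.natCast_dvd_natCast.1 h)) h2
        · exact absurd ((dvd_mul_right q r).trans (Int.natCast_dvd_natCast.1 h)) h1
        · exact absurd ((dvd_mul_right q r).trans (Int.natCast_dvd_natCast.1 h)) h1
        all_goals positivity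
    _ = (∑ q ∈ S, (if q ∣ w then (σ 0 q : ℝ) ^ B else 0)) * ∑ r ∈ T, (if r ∣ w then (σ 0 r : ℝ) ^ B else 0) := by
        rw [Finset.sum_mul_sum]
    _ ≤ (σ 0 w : ℝ) ^ (B + 1) * (σ 0 w : ℝ) ^ (B + 1) :=
        mul_le_mul (hone S) (hone T) (Finset.sum_nonneg fun _ _ => by positivity) (by positivity)
    _ = (σ 0 w : ℝ) ^ (2 * B + 2) := by rw [← pow_add]; congr 1; ring

/-- Real divisor-power bounds imply natural ones: `|γ_q| ≤ τ(q)^B ⇒ |γ_q| ≤ τ(q)^⌈B⌉`. [folklore] -/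
theorem abs_le_sigma_pow_ceil {B : ℝ} (hB : 0 ≤ B) {γ : ℕ → ℝ} (h : ∀ q, |γ q| ≤ (σ 0 q : ℝ) ^ B) (q : ℕ) :
    |γ q| ≤ (σ 0 q : ℝ) ^ ⌈B⌉₊ := by
  refine (h q).trans ?_
  rcases Nat.eq_zero_or_pos q with rfl | hq
  · simp only [ArithmeticFunction.map_zero, Nat.cast_zero]
    rcases hB.lt_or_eq with hB0 | hB0
    · rw [Real.zero_rpow hB0.ne']; positivity
    · rw [← hB0, Real.rpow_zero, show ⌈(0:ℝ)⌉₊ = 0 by simp, pow_zero]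
  · have h1 : (1 : ℝ) ≤ σ 0 q := by exact_mod_cast one_le_sigma_zero hq.ne'
    rw [← Real.rpow_natCast]
    exact Real.rpow_le_rpow_of_exponent_le h1 (Nat.le_ceil B)

/-- Embedding a box into the progression `w ≡ 0 (mod n)` of Lemma 3: for `n ≥ 1`, `0 ≤ u ≤ v`,
`|a| < u`, `v n ≤ y`,
`∑_{u<m≤v} τ(mn−a)^K ≤ ∑_{|a| < w ≤ y, n ∣ w} τ(w)^K τ(w − a)^K`. [folklore] -/
theorem sum_Ioc_sigma_shift_le (a : ℤ) (K : ℕ) {n : ℕ} (hn : 1 ≤ n) {u v y : ℝ} (hu : 0 ≤ u)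
    (hau : (|a| : ℝ) < u) (hvy : v * n ≤ y) :
    ∑ m ∈ Ioc ⌊u⌋₊ ⌊v⌋₊, (σ 0 (((m * n : ℕ) : ℤ) - a).toNat : ℝ) ^ K ≤
      ∑ w ∈ (Icc 1 ⌊y⌋₊).filter (fun w : ℕ => |a| < (w : ℤ) ∧ (w : ZMod n) = 0),
        (σ 0 w : ℝ) ^ K * (σ 0 ((w : ℤ) - a).toNat : ℝ) ^ K := by
  rcases lt_or_ge v u with hvu | huv
  · -- empty box
    have : Ioc ⌊u⌋₊ ⌊v⌋₊ = ∅ := Finset.Ioc_eq_empty (not_lt.2 (Nat.floor_le_floor hvu.le))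
    rw [this, Finset.sum_empty]
    exact Finset.sum_nonneg fun _ _ => by positivity
  have hv : 0 ≤ v := hu.trans huv
  have hinj : Set.InjOn (fun m : ℕ => m * n) (Ioc ⌊u⌋₊ ⌊v⌋₊ : Set ℕ) :=
    fun m₁ _ m₂ _ h => Nat.eq_of_mul_eq_mul_right hn h
  calc ∑ m ∈ Ioc ⌊u⌋₊ ⌊v⌋₊, (σ 0 (((m * n : ℕ) : ℤ) - a).toNat : ℝ) ^ K
      ≤ ∑ m ∈ Ioc ⌊u⌋₊ ⌊v⌋₊, (σ 0 (m * n) : ℝ) ^ K * (σ 0 (((m * n : ℕ) : ℤ) - a).toNat : ℝ) ^ K := by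
        refine Finset.sum_le_sum fun m hm => ?_
        rw [Finset.mem_Ioc] at hm
        have hm0 : m ≠ 0 := by omega
        have h1 : (1 : ℝ) ≤ (σ 0 (m * n) : ℝ) ^ K := by
          have : (1 : ℝ) ≤ σ 0 (m * n) := by
            exact_mod_cast one_le_sigma_zero (Nat.mul_ne_zero hm0 (by omega))
          exact one_le_pow₀ this
        exact le_mul_of_one_le_left (by positivity) h1
    _ = ∑ w ∈ (Ioc ⌊u⌋₊ ⌊v⌋₊).image (fun m : ℕ => m * n),
          (σ 0 w : ℝ) ^ K * (σ 0 ((w : ℤ) - a).toNat : ℝ) ^ K := by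
        rw [Finset.sum_image hinj]
    _ ≤ _ := by
        refine Finset.sum_le_sum_of_subset_of_nonneg (fun w hw => ?_) fun _ _ _ => by positivity
        rw [Finset.mem_image] at hw
        obtain ⟨m, hm, rfl⟩ := hw
        rw [Finset.mem_Ioc, Nat.floor_lt hu, Nat.le_floor_iff hv] at hm
        have hm1 : (|a| : ℝ) < m := hau.trans hm.1
        have hm1' : |a| < (m : ℤ) := by exact_mod_cast hm1
        have hmpos : 0 < m := by exact_mod_cast (abs_nonneg (a : ℝ)).trans_lt hm1
        rw [Finset.mem_filter, Finset.mem_Icc]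
        refine ⟨⟨Nat.mul_pos hmpos hn, ?_⟩, ?_, ?_⟩
        · refine Nat.le_floor ?_
          push_cast
          calc (m : ℝ) * n ≤ v * n := mul_le_mul_of_nonneg_right hm.2 (Nat.cast_nonneg n)
            _ ≤ y := hvy
        · calc |a| < (m : ℤ) := hm1'
            _ ≤ ((m * n : ℕ) : ℤ) := by
                push_cast
                exact le_mul_of_one_le_right (by positivity) (by exact_mod_cast hn)
        · push_cast
          simp

/-- The `φ⁻¹`-part of the trivial bound, summed over the moduli:
`∑_{q∼Q, r∼R} τ(q)^B τ(r)^B / φ(qr) ≤ (∑_{q ≤ 2Q'} τ(q)^B/φ(q)) (∑_{r ≤ 2R'} τ(r)^B/φ(r))` with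
`Q' = max Q 1`, `R' = max R 1` (`φ(qr) ≥ φ(q) φ(r)`). [folklore] -/
theorem sum_sum_sigma_pow_div_totient_le (B : ℕ) {Q R : ℝ} (hQ : 0 ≤ Q) (hR : 0 ≤ R) :
    ∑ q ∈ dyadic Q, ∑ r ∈ dyadic R, (σ 0 q : ℝ) ^ B * (σ 0 r : ℝ) ^ B / (Nat.totient (q * r) : ℝ) ≤
      (∑ q ∈ Icc 1 ⌊2 * max Q 1⌋₊, (σ 0 q : ℝ) ^ B / (Nat.totient q : ℝ)) *
        ∑ r ∈ Icc 1 ⌊2 * max R 1⌋₊, (σ 0 r : ℝ) ^ B / (Nat.totient r : ℝ) := by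
  have hsub : ∀ {T : ℝ}, 0 ≤ T → dyadic T ⊆ Icc 1 ⌊2 * max T 1⌋₊ := by
    intro T hT
    refine (dyadic_subset_Icc hT).trans (Finset.Icc_subset_Icc_right (Nat.floor_le_floor ?_))
    exact mul_le_mul_of_nonneg_left (le_max_left _ _) (by norm_num)
  rw [Finset.sum_mul_sum]
  calc ∑ q ∈ dyadic Q, ∑ r ∈ dyadic R, (σ 0 q : ℝ) ^ B * (σ 0 r : ℝ) ^ B / (Nat.totient (q * r) : ℝ)
      ≤ ∑ q ∈ dyadic Q, ∑ r ∈ dyadic R,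
          (σ 0 q : ℝ) ^ B / (Nat.totient q : ℝ) * ((σ 0 r : ℝ) ^ B / (Nat.totient r : ℝ)) := by
        refine Finset.sum_le_sum fun q hq => Finset.sum_le_sum fun r hr => ?_
        have hq1 := pos_of_mem_dyadic hQ hq
        have hr1 := pos_of_mem_dyadic hR hr
        have hφq : (0 : ℝ) < Nat.totient q := by exact_mod_cast Nat.totient_pos.2 hq1
        have hφr : (0 : ℝ) < Nat.totient r := by exact_mod_cast Nat.totient_pos.2 hr1
        have hφ : (Nat.totient q : ℝ) * Nat.totient r ≤ Nat.totient (q * r) := by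
          exact_mod_cast Nat.totient_super_multiplicative q r
        rw [div_mul_div_comm]
        exact div_le_div_of_nonneg_left (by positivity) (mul_pos hφq hφr) hφ
    _ ≤ _ := by
        refine Finset.sum_le_sum_of_subset_of_nonneg (hsub hQ) (fun _ _ _ => Finset.sum_nonneg
          fun _ _ => by positivity) |>.trans' ?_
        exact Finset.sum_le_sum fun q _ =>
          Finset.sum_le_sum_of_subset_of_nonneg (hsub hR) fun _ _ _ => by positivity

/-- The congruence `mn ≡ a (mod d)` means `d ∣ mn − a`. [folklore] -/
theorem natCast_dvd_sub_of_eq {m n d : ℕ} {a : ℤ}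
    (h : ((m * n : ℕ) : ZMod d) = (a : ZMod d)) : (d : ℤ) ∣ ((m * n : ℕ) : ℤ) - a := by
  have h' : (((m * n : ℕ) : ℤ) : ZMod d) = (a : ZMod d) := by rwa [Int.cast_natCast]
  rw [ZMod.intCast_eq_intCast_iff_dvd_sub] at h'
  rwa [dvd_sub_comm] at h'

/-- The congruence part of the trivial bound over a box `u < m ≤ v` with `|a| < u`, for
divisor-bounded `γ, δ`:
`∑_{m} ∑_{q,r} |γ_q||δ_r| ∑_{n∼N, mn≡a (qr)} |β_n| ≤ ∑_{n∼N} |β_n| ∑_{m} τ(mn − a)^{2B+2}`. [folklore] -/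
theorem sum_box_congr_part_le (a : ℤ) (B : ℕ) {u v N Q R : ℝ} (hu : 0 ≤ u) (hau : (|a| : ℝ) < u)
    (hN : 0 ≤ N) {β γ δ : ℕ → ℝ} (hγ : ∀ q, |γ q| ≤ (σ 0 q : ℝ) ^ B) (hδ : ∀ r, |δ r| ≤ (σ 0 r : ℝ) ^ B) :
    ∑ m ∈ Ioc ⌊u⌋₊ ⌊v⌋₊, ∑ q ∈ dyadic Q, ∑ r ∈ dyadic R, |γ q| * |δ r| *
        (∑ n ∈ dyadic N, if ((m * n : ℕ) : ZMod (q * r)) = (a : ZMod (q * r)) then |β n| else 0) ≤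
      ∑ n ∈ dyadic N, |β n| *
        ∑ m ∈ Ioc ⌊u⌋₊ ⌊v⌋₊, (σ 0 (((m * n : ℕ) : ℤ) - a).toNat : ℝ) ^ (2 * B + 2) := by
  -- put the `n`-sum outside the `q, r`-sums (for fixed `m`)
  have hswap : ∀ m : ℕ, (∑ q ∈ dyadic Q, ∑ r ∈ dyadic R, |γ q| * |δ r| *
      (∑ n ∈ dyadic N, if ((m * n : ℕ) : ZMod (q * r)) = (a : ZMod (q * r)) then |β n| else 0)) =
      ∑ n ∈ dyadic N, |β n| * ∑ q ∈ dyadic Q, ∑ r ∈ dyadic R,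
        (if ((m * n : ℕ) : ZMod (q * r)) = (a : ZMod (q * r)) then |γ q| * |δ r| else 0) := by
    intro m
    have h1 : (∑ q ∈ dyadic Q, ∑ r ∈ dyadic R, |γ q| * |δ r| *
        (∑ n ∈ dyadic N, if ((m * n : ℕ) : ZMod (q * r)) = (a : ZMod (q * r)) then |β n| else 0)) =
        ∑ q ∈ dyadic Q, ∑ r ∈ dyadic R, ∑ n ∈ dyadic N,
          (if ((m * n : ℕ) : ZMod (q * r)) = (a : ZMod (q * r)) then |β n| * (|γ q| * |δ r|) else 0) := by
      refine Finset.sum_congr rfl fun q _ => Finset.sum_congr rfl fun r _ => ?_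
      rw [Finset.mul_sum]
      exact Finset.sum_congr rfl fun n _ => by split_ifs <;> ring
    have h2 : (∑ n ∈ dyadic N, |β n| * ∑ q ∈ dyadic Q, ∑ r ∈ dyadic R,
        (if ((m * n : ℕ) : ZMod (q * r)) = (a : ZMod (q * r)) then |γ q| * |δ r| else 0)) =
        ∑ n ∈ dyadic N, ∑ q ∈ dyadic Q, ∑ r ∈ dyadic R,
          (if ((m * n : ℕ) : ZMod (q * r)) = (a : ZMod (q * r)) then |β n| * (|γ q| * |δ r|) else 0) := by
      refine Finset.sum_congr rfl fun n _ => ?_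
      rw [Finset.mul_sum]
      refine Finset.sum_congr rfl fun q _ => ?_
      rw [Finset.mul_sum]
      exact Finset.sum_congr rfl fun r _ => by split_ifs <;> ring
    rw [h1, h2]
    calc (∑ q ∈ dyadic Q, ∑ r ∈ dyadic R, ∑ n ∈ dyadic N,
          (if ((m * n : ℕ) : ZMod (q * r)) = (a : ZMod (q * r)) then |β n| * (|γ q| * |δ r|) else 0))
        = ∑ q ∈ dyadic Q, ∑ n ∈ dyadic N, ∑ r ∈ dyadic R,
          (if ((m * n : ℕ) : ZMod (q * r)) = (a : ZMod (q * r)) then |β n| * (|γ q| * |δ r|) else 0) :=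
          Finset.sum_congr rfl fun q _ => Finset.sum_comm
      _ = _ := Finset.sum_comm
  have hmono : ∀ n ∈ dyadic N, ∀ m ∈ Ioc ⌊u⌋₊ ⌊v⌋₊,
      (∑ q ∈ dyadic Q, ∑ r ∈ dyadic R,
        (if ((m * n : ℕ) : ZMod (q * r)) = (a : ZMod (q * r)) then |γ q| * |δ r| else 0)) ≤
      (σ 0 (((m * n : ℕ) : ℤ) - a).toNat : ℝ) ^ (2 * B + 2) := by
    intro n hn m hm
    -- `m, n` are fixed; `w = mn - a ≥ 1`
    have hn1 : 1 ≤ n := pos_of_mem_dyadic hN hn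
    rw [Finset.mem_Ioc, Nat.floor_lt hu] at hm
    have hm1 : (|a| : ℝ) < m := hau.trans hm.1
    have hm1' : |a| < (m : ℤ) := by exact_mod_cast hm1
    have hmn : |a| < ((m * n : ℕ) : ℤ) := by
      calc |a| < (m : ℤ) := hm1'
        _ ≤ ((m * n : ℕ) : ℤ) := by
            push_cast
            have : (0 : ℤ) ≤ m := by positivity
            exact le_mul_of_one_le_right this (by exact_mod_cast hn1)
    set w : ℕ := (((m * n : ℕ) : ℤ) - a).toNat with hw
    have hw0 : (0 : ℤ) < ((m * n : ℕ) : ℤ) - a := by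
      have := (abs_lt.1 hmn).2; have := le_abs_self a; omega
    have hwz : (w : ℤ) = ((m * n : ℕ) : ℤ) - a := Int.toNat_of_nonneg hw0.le
    have hwne : w ≠ 0 := by
      intro h0; rw [h0] at hwz; simp at hwz; omega
    calc ∑ q ∈ dyadic Q, ∑ r ∈ dyadic R,
          (if ((m * n : ℕ) : ZMod (q * r)) = (a : ZMod (q * r)) then |γ q| * |δ r| else 0)
        ≤ ∑ q ∈ dyadic Q, ∑ r ∈ dyadic R,
            (if ((q * r : ℕ) : ℤ) ∣ (w : ℤ) then (σ 0 q : ℝ) ^ B * (σ 0 r : ℝ) ^ B else 0) := by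
          refine Finset.sum_le_sum fun q _ => Finset.sum_le_sum fun r _ => ?_
          split_ifs with h1 h2
          · exact mul_le_mul (hγ q) (hδ r) (abs_nonneg _) (by positivity)
          · exact absurd (hwz ▸ natCast_dvd_sub_of_eq h1) h2
          · positivity
          · exact le_rfl
      _ ≤ (σ 0 w : ℝ) ^ (2 * B + 2) := sum_sum_dvd_sigma_pow_le _ _ B hwne
  calc (∑ m ∈ Ioc ⌊u⌋₊ ⌊v⌋₊, ∑ q ∈ dyadic Q, ∑ r ∈ dyadic R, |γ q| * |δ r| *
        (∑ n ∈ dyadic N, if ((m * n : ℕ) : ZMod (q * r)) = (a : ZMod (q * r)) then |β n| else 0))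
      = ∑ m ∈ Ioc ⌊u⌋₊ ⌊v⌋₊, ∑ n ∈ dyadic N, |β n| * ∑ q ∈ dyadic Q, ∑ r ∈ dyadic R,
          (if ((m * n : ℕ) : ZMod (q * r)) = (a : ZMod (q * r)) then |γ q| * |δ r| else 0) :=
        Finset.sum_congr rfl fun m _ => hswap m
    _ = ∑ n ∈ dyadic N, ∑ m ∈ Ioc ⌊u⌋₊ ⌊v⌋₊, |β n| * ∑ q ∈ dyadic Q, ∑ r ∈ dyadic R,
          (if ((m * n : ℕ) : ZMod (q * r)) = (a : ZMod (q * r)) then |γ q| * |δ r| else 0) :=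
        Finset.sum_comm
    _ ≤ ∑ n ∈ dyadic N, ∑ m ∈ Ioc ⌊u⌋₊ ⌊v⌋₊, |β n| *
          (σ 0 (((m * n : ℕ) : ℤ) - a).toNat : ℝ) ^ (2 * B + 2) :=
        Finset.sum_le_sum fun n hn => Finset.sum_le_sum fun m hm =>
          mul_le_mul_of_nonneg_left (hmono n hn m hm) (abs_nonneg _)
    _ = _ := Finset.sum_congr rfl fun n _ => by rw [Finset.mul_sum]

/-- `(∑_{n∼N} τ(n)^{2r})^{1/2} ≤ C N^{1/2} (log 2N)^{2^{2r}}` for `N ≥ 1`. [folklore] -/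
theorem exists_sqrt_sum_dyadic_sigma_pow_le (r : ℕ) :
    ∃ C : ℝ, 0 < C ∧ ∀ N : ℝ, 1 ≤ N →
      Real.sqrt (∑ n ∈ dyadic N, (σ 0 n : ℝ) ^ (2 * r)) ≤ C * N ^ (1 / 2 : ℝ) * Real.log (2 * N) ^ (2 ^ (2 * r)) := by
  obtain ⟨C, hC, h⟩ := exists_sum_dyadic_sigma_zero_pow_le (2 * r)
  refine ⟨Real.sqrt C, Real.sqrt_pos.2 hC, fun N hN => ?_⟩
  have hlog : 0 ≤ Real.log (2 * N) := Real.log_nonneg (by linarith)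
  calc Real.sqrt (∑ n ∈ dyadic N, (σ 0 n : ℝ) ^ (2 * r))
      ≤ Real.sqrt (C * N * Real.log (2 * N) ^ (2 ^ (2 * r + 1))) := Real.sqrt_le_sqrt (h N hN)
    _ = Real.sqrt (C * N) * Real.sqrt ((Real.log (2 * N) ^ (2 ^ (2 * r))) ^ 2) := by
        rw [← Real.sqrt_mul (by positivity), pow_succ, pow_mul]
    _ = Real.sqrt C * Real.sqrt N * Real.log (2 * N) ^ (2 ^ (2 * r)) := by
        rw [Real.sqrt_sq (by positivity), Real.sqrt_mul hC.le]
    _ = Real.sqrt C * N ^ (1 / 2 : ℝ) * Real.log (2 * N) ^ (2 ^ (2 * r)) := by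
        rw [Real.sqrt_eq_rpow N]

/-- **The trivial bound for a box of rows** (BFI's "trivial estimation", cf. (12.1) p. 236 and
Lemma 3 p. 211).  For `a ≠ 0` and divisor-bounded `γ, δ` (`|γ_q| ≤ τ(q)^B`, `|δ_r| ≤ τ(r)^B`) there
are `C, c, y₀` such that for every box `u < m ≤ v` with `1 ≤ u ≤ v ≤ 2u`, `|a| < u`, every `N ≥ 1`
with `4uN ≥ y₀`, `uN ≤ x`, `2N ≤ (4uN)^{1−ε₃}`, all `0 ≤ Q, R ≤ x²` (`x ≥ 3`) and `|ρ| ≤ 1`: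
`|∑_{u<m≤v} ρ(m) F(m)| ≤ C ‖β‖ N^{1/2} u (log x)^c`.
Proof: `|F(m)|` is at most the congruence part plus the `φ⁻¹`-part (`abs_rowF_le`); the former is
`≤ ∑_n |β_n| ∑_m τ(mn−a)^{2B+2}` (`sum_box_congr_part_le`), and Lemma 3 of BFI (PROVED in the tree,
`BombieriFriedlanderIwaniecLemma3_holds`) in the class `0 (mod n)` followed by Cauchy's inequality in
`n` gives `≪ u ‖β‖ N^{1/2} ℒ^c`; the latter is `|I| ‖β‖₁ ∑_{q,r} τ(q)^Bτ(r)^B/φ(qr) ≪ u ‖β‖ N^{1/2} ℒ^c`.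
[cite: BombieriFriedlanderIwaniecActa1986, §2 Lemma 3 p. 211; §12 (12.1) p. 236] -/
theorem abs_boxSum_rowF_le {a : ℤ} (ha : a ≠ 0) (B : ℕ) {ε₃ : ℝ} (hε₃ : 0 < ε₃) :
    ∃ C c y₀ : ℝ, 0 ≤ C ∧ 0 ≤ c ∧ ∀ (x u v N Q R : ℝ) (ρ β γ δ : ℕ → ℝ),
      3 ≤ x → y₀ ≤ 4 * u * N → 1 ≤ u → u ≤ v → v ≤ 2 * u → 1 ≤ N → u * N ≤ x → (|a| : ℝ) < u →
      2 * N ≤ (4 * u * N) ^ (1 - ε₃) →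
      0 ≤ Q → Q ≤ x ^ 2 → 0 ≤ R → R ≤ x ^ 2 →
      (∀ m, |ρ m| ≤ 1) → (∀ q, |γ q| ≤ (σ 0 q : ℝ) ^ B) → (∀ r, |δ r| ≤ (σ 0 r : ℝ) ^ B) →
      |boxSum (fun m => ρ m * rowF a N Q R β γ δ m) u v| ≤
        C * Real.sqrt (l2Sq N β) * N ^ (1 / 2 : ℝ) * u * Real.log x ^ c := by
  obtain ⟨B₃, C₃, x₃, hL3⟩ := BombieriFriedlanderIwaniecLemma3_holds a ha ((2 * B + 2 : ℕ) : ℝ)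
    (by positivity) ε₃ hε₃
  set b : ℝ := max B₃ 0 with hb
  have hb0 : 0 ≤ b := le_max_right _ _
  set r₃ : ℕ := ⌈b⌉₊ with hr₃
  obtain ⟨Cτ, hCτ, hτ⟩ := exists_sqrt_sum_dyadic_sigma_pow_le r₃
  obtain ⟨Cφ, hCφ, hφ⟩ := exists_sum_sigma_zero_pow_div_totient_le_real B
  set c : ℝ := max (b + (2 : ℝ) ^ (2 * r₃)) ((2 : ℝ) ^ (B + 3)) with hc
  have hc0 : 0 ≤ c := le_trans (by positivity) (le_max_right _ _)
  refine ⟨(4 * max C₃ 0 * Cτ + 4 * Cφ ^ 2) * 3 ^ c, c, max x₃ (Real.exp 1), by positivity, hc0,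
    fun x u v N Q R ρ β γ δ hx hy hu huv hvu hN huNx hau hNy hQ hQx hR hRx hρ hγ hδ => ?_⟩
  -- notation and basic facts
  set y : ℝ := 4 * u * N with hydef
  have hyx₃ : x₃ ≤ y := le_trans (le_max_left _ _) hy
  have hye : Real.exp 1 ≤ y := le_trans (le_max_right _ _) hy
  have hy0 : 0 < y := (Real.exp_pos 1).trans_le hye
  have hlogy : 1 ≤ Real.log y := by rwa [Real.le_log_iff_exp_le hy0]
  have hx1 : (1 : ℝ) ≤ x := by linarith
  have hx0 : 0 < x := by linarith
  set L : ℝ := Real.log x with hL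
  have hL2 : Real.log 2 ≤ L := Real.log_le_log (by norm_num) (by linarith)
  have hlog2 : (0.6931471803 : ℝ) < Real.log 2 := Real.log_two_gt_d9
  have hL0 : 0 < L := by linarith
  have hlog4x : Real.log (4 * x) ≤ 3 * L := by
    rw [Real.log_mul (by norm_num) hx0.ne', show (4 : ℝ) = 2 ^ 2 by norm_num, Real.log_pow]
    push_cast; linarith
  have hlogyL : Real.log y ≤ 3 * L := by
    refine le_trans (Real.log_le_log hy0 ?_) hlog4x
    rw [hydef]; nlinarith
  have h3L1 : 1 ≤ 3 * L := hlogy.trans hlogyL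
  have hlog2x : Real.log (2 * x) ≤ 3 * L :=
    le_trans (Real.log_le_log (by linarith) (by linarith)) hlog4x
  have hlog2xx : Real.log (2 * x ^ 2) ≤ 3 * L := by
    rw [Real.log_mul (by norm_num) (by positivity), Real.log_pow]; push_cast; linarith
  have hu0 : 0 < u := by linarith
  have hN0 : 0 < N := by linarith
  set I : Finset ℕ := Ioc ⌊u⌋₊ ⌊v⌋₊ with hI
  -- the cardinality of the box
  have hcardI : (I.card : ℝ) ≤ 2 * u := by
    rw [hI, Nat.card_Ioc]
    have h1 : (⌊v⌋₊ : ℝ) ≤ v := Nat.floor_le (by linarith)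
    have h2 : u < (⌊u⌋₊ : ℝ) + 1 := Nat.lt_floor_add_one u
    have hle : ⌊u⌋₊ ≤ ⌊v⌋₊ := Nat.floor_le_floor huv
    have h3 : ((⌊v⌋₊ - ⌊u⌋₊ : ℕ) : ℝ) = (⌊v⌋₊ : ℝ) - ⌊u⌋₊ := by rw [Nat.cast_sub hle]
    rw [h3]; linarith
  -- `‖β‖₁ ≤ 2 ‖β‖ N^{1/2}`
  have hβ1 : ∑ n ∈ dyadic N, |β n| ≤ 2 * Real.sqrt (l2Sq N β) * N ^ (1 / 2 : ℝ) := by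
    refine (sum_abs_le_sqrt_l2Sq hN0.le β).trans ?_
    have h1 : Real.sqrt (2 * N + 1) ≤ 2 * N ^ (1 / 2 : ℝ) := by
      rw [← Real.sqrt_eq_rpow]
      calc Real.sqrt (2 * N + 1) ≤ Real.sqrt (4 * N) := Real.sqrt_le_sqrt (by linarith)
        _ = Real.sqrt 4 * Real.sqrt N := Real.sqrt_mul (by norm_num) N
        _ = 2 * Real.sqrt N := by rw [show (4 : ℝ) = 2 ^ 2 by norm_num, Real.sqrt_sq (by norm_num)]
    calc Real.sqrt (l2Sq N β) * Real.sqrt (2 * N + 1) ≤ Real.sqrt (l2Sq N β) * (2 * N ^ (1 / 2 : ℝ)) :=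
          mul_le_mul_of_nonneg_left h1 (Real.sqrt_nonneg _)
      _ = _ := by ring
  -- Step 0: rows bounded by congruence part + totient part
  have hstep0 : |boxSum (fun m => ρ m * rowF a N Q R β γ δ m) u v| ≤
      (∑ m ∈ I, ∑ q ∈ dyadic Q, ∑ r ∈ dyadic R, |γ q| * |δ r| *
        (∑ n ∈ dyadic N, if ((m * n : ℕ) : ZMod (q * r)) = (a : ZMod (q * r)) then |β n| else 0)) +
      I.card * ((∑ n ∈ dyadic N, |β n|) *
        ∑ q ∈ dyadic Q, ∑ r ∈ dyadic R, (σ 0 q : ℝ) ^ B * (σ 0 r : ℝ) ^ B / (Nat.totient (q * r) : ℝ)) := by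
    unfold boxSum
    refine (Finset.abs_sum_le_sum_abs _ _).trans ?_
    rw [← hI]
    have hrow : ∀ m ∈ I, |ρ m * rowF a N Q R β γ δ m| ≤
        (∑ q ∈ dyadic Q, ∑ r ∈ dyadic R, |γ q| * |δ r| *
          (∑ n ∈ dyadic N, if ((m * n : ℕ) : ZMod (q * r)) = (a : ZMod (q * r)) then |β n| else 0)) +
        (∑ n ∈ dyadic N, |β n|) *
          ∑ q ∈ dyadic Q, ∑ r ∈ dyadic R, (σ 0 q : ℝ) ^ B * (σ 0 r : ℝ) ^ B / (Nat.totient (q * r) : ℝ) := by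
      intro m _
      rw [abs_mul]
      refine (mul_le_of_le_one_left (abs_nonneg _) (hρ m)).trans ?_
      refine (abs_rowF_le a N Q R β γ δ m).trans ?_
      simp_rw [mul_add, Finset.sum_add_distrib]
      refine add_le_add le_rfl ?_
      rw [Finset.mul_sum]
      refine Finset.sum_le_sum fun q _ => ?_
      rw [Finset.mul_sum]
      refine Finset.sum_le_sum fun r _ => ?_
      have hφ0 : (0 : ℝ) ≤ (Nat.totient (q * r) : ℝ) := Nat.cast_nonneg _
      calc |γ q| * |δ r| * ((∑ n ∈ dyadic N, |β n|) / (Nat.totient (q * r) : ℝ))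
          = (|γ q| * |δ r| * ∑ n ∈ dyadic N, |β n|) / (Nat.totient (q * r) : ℝ) := by ring
        _ ≤ ((σ 0 q : ℝ) ^ B * (σ 0 r : ℝ) ^ B * ∑ n ∈ dyadic N, |β n|) / (Nat.totient (q * r) : ℝ) :=
            div_le_div_of_nonneg_right (mul_le_mul_of_nonneg_right
              (mul_le_mul (hγ q) (hδ r) (abs_nonneg _) (by positivity))
              (Finset.sum_nonneg fun _ _ => abs_nonneg _)) hφ0
        _ = (∑ n ∈ dyadic N, |β n|) * ((σ 0 q : ℝ) ^ B * (σ 0 r : ℝ) ^ B / (Nat.totient (q * r) : ℝ)) := by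
            ring
    calc ∑ m ∈ I, |ρ m * rowF a N Q R β γ δ m|
        ≤ ∑ m ∈ I, ((∑ q ∈ dyadic Q, ∑ r ∈ dyadic R, |γ q| * |δ r| *
            (∑ n ∈ dyadic N, if ((m * n : ℕ) : ZMod (q * r)) = (a : ZMod (q * r)) then |β n| else 0)) +
          (∑ n ∈ dyadic N, |β n|) *
            ∑ q ∈ dyadic Q, ∑ r ∈ dyadic R, (σ 0 q : ℝ) ^ B * (σ 0 r : ℝ) ^ B / (Nat.totient (q * r) : ℝ)) :=
          Finset.sum_le_sum hrow
      _ = _ := by rw [Finset.sum_add_distrib, Finset.sum_const, nsmul_eq_mul]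
  -- Step 1: the congruence part
  have h3Lc : ∀ {p : ℝ}, p ≤ c → (3 * L) ^ p ≤ (3 * L) ^ c := fun hp =>
    Real.rpow_le_rpow_of_exponent_le h3L1 hp
  have hNx : N ≤ x := le_trans (le_mul_of_one_le_left hN0.le hu) huNx
  have hlog2N : Real.log (2 * N) ≤ 3 * L :=
    le_trans (Real.log_le_log (by linarith) (by linarith)) hlog2x
  have hlog2N0 : 0 ≤ Real.log (2 * N) := Real.log_nonneg (by linarith)
  have hP1 : (∑ m ∈ I, ∑ q ∈ dyadic Q, ∑ r ∈ dyadic R, |γ q| * |δ r| *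
        (∑ n ∈ dyadic N, if ((m * n : ℕ) : ZMod (q * r)) = (a : ZMod (q * r)) then |β n| else 0)) ≤
      4 * max C₃ 0 * Cτ * (3 * L) ^ c * Real.sqrt (l2Sq N β) * N ^ (1 / 2 : ℝ) * u := by
    refine (sum_box_congr_part_le a B hu0.le hau hN0.le hγ hδ).trans ?_
    -- Lemma 3 for each `n`
    have hper : ∀ n ∈ dyadic N,
        ∑ m ∈ I, (σ 0 (((m * n : ℕ) : ℤ) - a).toNat : ℝ) ^ (2 * B + 2) ≤
          4 * max C₃ 0 * u * (3 * L) ^ b * (σ 0 n : ℝ) ^ r₃ := by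
      intro n hn
      have hn1 : 1 ≤ n := pos_of_mem_dyadic hN0.le hn
      obtain ⟨hnN, hn2N⟩ := (mem_dyadic hN0.le).1 hn
      have hn0 : (0 : ℝ) < n := by exact_mod_cast hn1
      have hvy : v * n ≤ y := by
        rw [hydef]
        calc v * n ≤ (2 * u) * (2 * N) := mul_le_mul hvu hn2N hn0.le (by linarith)
          _ = 4 * u * N := by ring
      have hny : (n : ℝ) ≤ y ^ (1 - ε₃) := hn2N.trans hNy
      have hτn : (1 : ℝ) ≤ σ 0 n := by exact_mod_cast one_le_sigma_zero (by omega : n ≠ 0)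
      have h3 := hL3 y hyx₃ n hn1 hny 0
      simp only [Real.rpow_natCast] at h3
      have hbase : (1 : ℝ) ≤ (σ 0 n : ℝ) * Real.log y := one_le_mul_of_one_le_of_one_le hτn hlogy
      have hyn : y / n ≤ 4 * u := by
        rw [div_le_iff₀ hn0, hydef]
        exact mul_le_mul_of_nonneg_left hnN.le (by positivity)
      have hpow : ((σ 0 n : ℝ) * Real.log y) ^ B₃ ≤ (σ 0 n : ℝ) ^ r₃ * (3 * L) ^ b := by
        calc ((σ 0 n : ℝ) * Real.log y) ^ B₃ ≤ ((σ 0 n : ℝ) * Real.log y) ^ b :=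
              Real.rpow_le_rpow_of_exponent_le hbase (le_max_left _ _)
          _ = (σ 0 n : ℝ) ^ b * Real.log y ^ b := Real.mul_rpow (by positivity) (by positivity)
          _ ≤ (σ 0 n : ℝ) ^ r₃ * (3 * L) ^ b := by
              refine mul_le_mul ?_ (Real.rpow_le_rpow (by positivity) hlogyL hb0)
                (by positivity) (by positivity)
              rw [← Real.rpow_natCast]
              exact Real.rpow_le_rpow_of_exponent_le hτn (Nat.le_ceil b)
      calc ∑ m ∈ I, (σ 0 (((m * n : ℕ) : ℤ) - a).toNat : ℝ) ^ (2 * B + 2)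
          ≤ ∑ w ∈ (Icc 1 ⌊y⌋₊).filter (fun w : ℕ => |a| < (w : ℤ) ∧ (w : ZMod n) = 0),
              (σ 0 w : ℝ) ^ (2 * B + 2) * (σ 0 ((w : ℤ) - a).toNat : ℝ) ^ (2 * B + 2) :=
            sum_Ioc_sigma_shift_le a (2 * B + 2) hn1 hu0.le hau hvy
        _ ≤ C₃ * (y / n) * ((σ 0 n : ℝ) * Real.log y) ^ B₃ := h3
        _ = C₃ * ((y / n) * ((σ 0 n : ℝ) * Real.log y) ^ B₃) := by ring
        _ ≤ max C₃ 0 * ((y / n) * ((σ 0 n : ℝ) * Real.log y) ^ B₃) :=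
            mul_le_mul_of_nonneg_right (le_max_left _ _) (by positivity)
        _ ≤ max C₃ 0 * ((4 * u) * ((σ 0 n : ℝ) ^ r₃ * (3 * L) ^ b)) :=
            mul_le_mul_of_nonneg_left (mul_le_mul hyn hpow (by positivity) (by positivity))
              (le_max_right _ _)
        _ = 4 * max C₃ 0 * u * (3 * L) ^ b * (σ 0 n : ℝ) ^ r₃ := by ring
    have hbc : (3 * L) ^ b * (3 * L) ^ (2 ^ (2 * r₃)) ≤ (3 * L) ^ c := by
      rw [← Real.rpow_natCast, ← Real.rpow_add (by positivity)]
      push_cast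
      exact h3Lc (le_max_left _ _)
    calc ∑ n ∈ dyadic N, |β n| * ∑ m ∈ I, (σ 0 (((m * n : ℕ) : ℤ) - a).toNat : ℝ) ^ (2 * B + 2)
        ≤ ∑ n ∈ dyadic N, |β n| * (4 * max C₃ 0 * u * (3 * L) ^ b * (σ 0 n : ℝ) ^ r₃) :=
          Finset.sum_le_sum fun n hn => mul_le_mul_of_nonneg_left (hper n hn) (abs_nonneg _)
      _ = 4 * max C₃ 0 * u * (3 * L) ^ b * ∑ n ∈ dyadic N, |β n| * (σ 0 n : ℝ) ^ r₃ := by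
          rw [Finset.mul_sum]; exact Finset.sum_congr rfl fun n _ => by ring
      _ ≤ 4 * max C₃ 0 * u * (3 * L) ^ b *
            (Real.sqrt (l2Sq N β) * Real.sqrt (∑ n ∈ dyadic N, (σ 0 n : ℝ) ^ (2 * r₃))) :=
          mul_le_mul_of_nonneg_left (sum_abs_mul_sigma_pow_le N β r₃) (by positivity)
      _ ≤ 4 * max C₃ 0 * u * (3 * L) ^ b *
            (Real.sqrt (l2Sq N β) * (Cτ * N ^ (1 / 2 : ℝ) * (3 * L) ^ (2 ^ (2 * r₃)))) := by
          refine mul_le_mul_of_nonneg_left (mul_le_mul_of_nonneg_left ?_ (Real.sqrt_nonneg _))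
            (by positivity)
          exact (hτ N hN).trans (mul_le_mul_of_nonneg_left (pow_le_pow_left₀ hlog2N0 hlog2N _)
            (by positivity))
      _ = 4 * max C₃ 0 * Cτ * ((3 * L) ^ b * (3 * L) ^ (2 ^ (2 * r₃))) *
            (Real.sqrt (l2Sq N β) * N ^ (1 / 2 : ℝ) * u) := by ring
      _ ≤ 4 * max C₃ 0 * Cτ * (3 * L) ^ c * (Real.sqrt (l2Sq N β) * N ^ (1 / 2 : ℝ) * u) :=
          mul_le_mul_of_nonneg_right (mul_le_mul_of_nonneg_left hbc (by positivity)) (by positivity)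
      _ = _ := by ring
  -- Step 2: the totient part
  have hP2 : (I.card : ℝ) * ((∑ n ∈ dyadic N, |β n|) *
        ∑ q ∈ dyadic Q, ∑ r ∈ dyadic R, (σ 0 q : ℝ) ^ B * (σ 0 r : ℝ) ^ B / (Nat.totient (q * r) : ℝ)) ≤
      4 * Cφ ^ 2 * (3 * L) ^ c * Real.sqrt (l2Sq N β) * N ^ (1 / 2 : ℝ) * u := by
    have hone : ∀ {T : ℝ}, 0 ≤ T → T ≤ x ^ 2 →
        ∑ q ∈ Icc 1 ⌊2 * max T 1⌋₊, (σ 0 q : ℝ) ^ B / (Nat.totient q : ℝ) ≤ Cφ * (3 * L) ^ (2 ^ (B + 2)) := by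
      intro T hT hTx
      have h2 : (2 : ℝ) ≤ 2 * max T 1 := by linarith [le_max_right T 1]
      refine (hφ _ h2).trans (mul_le_mul_of_nonneg_left (pow_le_pow_left₀ (Real.log_nonneg (by linarith))
        ((Real.log_le_log (by linarith) ?_).trans hlog2xx) _) hCφ.le)
      exact mul_le_mul_of_nonneg_left (max_le hTx (by nlinarith)) (by norm_num)
    have hS : ∑ q ∈ dyadic Q, ∑ r ∈ dyadic R, (σ 0 q : ℝ) ^ B * (σ 0 r : ℝ) ^ B / (Nat.totient (q * r) : ℝ) ≤
        Cφ ^ 2 * (3 * L) ^ c := by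
      refine (sum_sum_sigma_pow_div_totient_le B hQ hR).trans ?_
      calc (∑ q ∈ Icc 1 ⌊2 * max Q 1⌋₊, (σ 0 q : ℝ) ^ B / (Nat.totient q : ℝ)) *
            ∑ r ∈ Icc 1 ⌊2 * max R 1⌋₊, (σ 0 r : ℝ) ^ B / (Nat.totient r : ℝ)
          ≤ (Cφ * (3 * L) ^ (2 ^ (B + 2))) * (Cφ * (3 * L) ^ (2 ^ (B + 2))) :=
            mul_le_mul (hone hQ hQx) (hone hR hRx) (Finset.sum_nonneg fun _ _ => by positivity)
              (by positivity)
        _ = Cφ ^ 2 * (3 * L) ^ ((2 : ℝ) ^ (B + 3)) := by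
            rw [← Real.rpow_natCast (3 * L)]; push_cast
            rw [show (2 : ℝ) ^ (B + 3) = 2 ^ (B + 2) + 2 ^ (B + 2) by ring, Real.rpow_add (by positivity)]
            ring
        _ ≤ Cφ ^ 2 * (3 * L) ^ c := mul_le_mul_of_nonneg_left (h3Lc (le_max_right _ _)) (by positivity)
    calc (I.card : ℝ) * ((∑ n ∈ dyadic N, |β n|) *
          ∑ q ∈ dyadic Q, ∑ r ∈ dyadic R, (σ 0 q : ℝ) ^ B * (σ 0 r : ℝ) ^ B / (Nat.totient (q * r) : ℝ))
        ≤ (2 * u) * ((2 * Real.sqrt (l2Sq N β) * N ^ (1 / 2 : ℝ)) * (Cφ ^ 2 * (3 * L) ^ c)) := by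
          refine mul_le_mul hcardI (mul_le_mul hβ1 hS (Finset.sum_nonneg fun _ _ =>
            Finset.sum_nonneg fun _ _ => by positivity) (by positivity)) (by positivity) (by positivity)
      _ = _ := by ring
  -- conclusion
  calc |boxSum (fun m => ρ m * rowF a N Q R β γ δ m) u v|
      ≤ _ := hstep0
    _ ≤ 4 * max C₃ 0 * Cτ * (3 * L) ^ c * Real.sqrt (l2Sq N β) * N ^ (1 / 2 : ℝ) * u +
        4 * Cφ ^ 2 * (3 * L) ^ c * Real.sqrt (l2Sq N β) * N ^ (1 / 2 : ℝ) * u := add_le_add hP1 hP2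
    _ = (4 * max C₃ 0 * Cτ + 4 * Cφ ^ 2) * 3 ^ c * Real.sqrt (l2Sq N β) * N ^ (1 / 2 : ℝ) * u *
        L ^ c := by
        rw [Real.mul_rpow (by norm_num) hL0.le]; ring

/-! ### The hypotheses of Theorem 5* at the lower dyadic scales -/

/-- From (A₁) with `x > 1`: `ε ≤ 1/2`. [folklore] -/
theorem eps_le_half {x ε N : ℝ} (hx : 1 < x) (hN1 : x ^ ε ≤ N) (hN2 : N ≤ x ^ (1 - ε)) : ε ≤ 1 / 2 := by
  have h := (Real.rpow_le_rpow_left_iff hx).1 (hN1.trans hN2)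
  linarith

/-- Condition (12.5) forces `QR < x^{1−ε}` (`Q < x^{1−2ε}` and `Q³R⁴ < x^{3−2ε}`, since
`M ≤ x^{1−ε}`). [cite: BombieriFriedlanderIwaniecActa1986, §12 (12.5) p. 237] -/
theorem QR_lt_of_thm5Threshold {x ε M N Q R : ℝ} (hx : 1 < x) (hMN : M * N = x)
    (hN1 : x ^ ε ≤ N) (hQ : 1 / 2 ≤ Q) (hR : 0 < R) (hthr : x ^ ε * thm5Threshold x Q R < M) :
    Q * R < x ^ (1 - ε) ∧ Q < x ^ (1 - 2 * ε) ∧ R < 2 * x ^ (1 - 2 * ε) := by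
  have hx0 : 0 < x := by linarith
  have hxe : 0 < x ^ ε := Real.rpow_pos_of_pos hx0 ε
  have hN0 : 0 < N := hxe.trans_le hN1
  have hM : M ≤ x ^ (1 - ε) := by
    have hM' : M = x / N := by field_simp; linarith
    rw [hM', div_le_iff₀ hN0, Real.rpow_sub hx0, Real.rpow_one, div_mul_eq_mul_div, le_div_iff₀ hxe]
    exact mul_le_mul_of_nonneg_left hN1 hx0.le
  -- `T < x^{1-2ε}`
  have hT : thm5Threshold x Q R < x ^ (1 - 2 * ε) := by
    have h1 : x ^ ε * thm5Threshold x Q R < x ^ ε * x ^ (1 - 2 * ε) := by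
      calc x ^ ε * thm5Threshold x Q R < M := hthr
        _ ≤ x ^ (1 - ε) := hM
        _ = x ^ ε * x ^ (1 - 2 * ε) := by rw [← Real.rpow_add hx0]; ring_nf
    exact lt_of_mul_lt_mul_left h1 hxe.le
  have hTQ : Q ≤ thm5Threshold x Q R := le_trans (le_max_left _ _) (le_max_left _ _)
  have hT4 : x ^ (-2 : ℝ) * Q ^ 3 * R ^ 4 ≤ thm5Threshold x Q R :=
    le_trans (le_max_right _ _) (le_max_right _ _)
  have hT3 : Q ^ (1 / 2 : ℝ) * R ≤ thm5Threshold x Q R := le_trans (le_max_left _ _) (le_max_right _ _)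
  have hQlt : Q < x ^ (1 - 2 * ε) := hTQ.trans_lt hT
  refine ⟨?_, hQlt, ?_⟩
  · -- `(QR)^4 = Q · Q³R⁴ < x^{1-2ε} · x^{3-2ε} = (x^{1-ε})^4`
    have h34 : Q ^ 3 * R ^ 4 < x ^ (3 - 2 * ε) := by
      have h1 : x ^ (-2 : ℝ) * (Q ^ 3 * R ^ 4) < x ^ (1 - 2 * ε) := by
        rw [← mul_assoc]; exact hT4.trans_lt hT
      have h2 : Q ^ 3 * R ^ 4 = x ^ (2 : ℝ) * (x ^ (-2 : ℝ) * (Q ^ 3 * R ^ 4)) := by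
        rw [← mul_assoc, ← Real.rpow_add hx0]; norm_num
      rw [h2, show (3 : ℝ) - 2 * ε = 2 + (1 - 2 * ε) by ring, Real.rpow_add hx0]
      exact mul_lt_mul_of_pos_left h1 (Real.rpow_pos_of_pos hx0 _)
    have h4 : (Q * R) ^ 4 < (x ^ (1 - ε)) ^ 4 := by
      calc (Q * R) ^ 4 = Q * (Q ^ 3 * R ^ 4) := by ring
        _ < x ^ (1 - 2 * ε) * x ^ (3 - 2 * ε) := mul_lt_mul'' hQlt h34 (by linarith) (by positivity)
        _ = (x ^ (1 - ε)) ^ 4 := by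
            rw [← Real.rpow_add hx0, ← Real.rpow_natCast, ← Real.rpow_mul hx0.le]; norm_num; ring_nf
    exact lt_of_pow_lt_pow_left₀ 4 (by positivity) h4
  · -- `R ≤ 2 Q^{1/2} R < 2 x^{1-2ε}` as `Q^{1/2} ≥ (1/2)^{1/2} ≥ 1/2`
    have hQh : 1 / 2 ≤ Q ^ (1 / 2 : ℝ) := by
      calc (1 / 2 : ℝ) = (1 / 2 : ℝ) ^ (1 : ℝ) := (Real.rpow_one _).symm
        _ ≤ (1 / 2 : ℝ) ^ (1 / 2 : ℝ) :=
            Real.rpow_le_rpow_of_exponent_ge (by norm_num) (by norm_num) (by norm_num)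
        _ ≤ Q ^ (1 / 2 : ℝ) := Real.rpow_le_rpow (by norm_num) hQ (by norm_num)
    calc R = R * 1 := (mul_one R).symm
      _ ≤ R * (2 * Q ^ (1 / 2 : ℝ)) := mul_le_mul_of_nonneg_left (by linarith) hR.le
      _ = 2 * (Q ^ (1 / 2 : ℝ) * R) := by ring
      _ < 2 * x ^ (1 - 2 * ε) := by linarith [hT3.trans_lt hT]

/-- The threshold of (12.5) at the scale `x/t` is at most `t²` times the threshold at `x`
(`t ≥ 1`). [folklore] -/
theorem thm5Threshold_div_le {x t Q R : ℝ} (hx : 0 < x) (ht : 1 ≤ t) (hQ : 0 ≤ Q) (hR : 0 ≤ R) :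
    thm5Threshold (x / t) Q R ≤ t ^ 2 * thm5Threshold x Q R := by
  have ht0 : 0 < t := by linarith
  have ht2 : 1 ≤ t ^ 2 := one_le_pow₀ ht
  unfold thm5Threshold
  rw [mul_max_of_nonneg _ _ (by positivity), mul_max_of_nonneg _ _ (by positivity),
    mul_max_of_nonneg _ _ (by positivity)]
  have h1 : Q ≤ t ^ 2 * Q := le_mul_of_one_le_left hQ ht2
  have h2 : (x / t)⁻¹ * Q * R ^ 4 ≤ t ^ 2 * (x⁻¹ * Q * R ^ 4) := by
    rw [inv_div]
    calc t / x * Q * R ^ 4 = t * (x⁻¹ * Q * R ^ 4) := by ring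
      _ ≤ t ^ 2 * (x⁻¹ * Q * R ^ 4) :=
          mul_le_mul_of_nonneg_right (by nlinarith) (by positivity)
  have h3 : Q ^ (1 / 2 : ℝ) * R ≤ t ^ 2 * (Q ^ (1 / 2 : ℝ) * R) := le_mul_of_one_le_left (by positivity) ht2
  have h4 : (x / t) ^ (-2 : ℝ) * Q ^ 3 * R ^ 4 ≤ t ^ 2 * (x ^ (-2 : ℝ) * Q ^ 3 * R ^ 4) := by
    rw [Real.div_rpow hx.le ht0.le, show t ^ (-2 : ℝ) = (t ^ 2)⁻¹ by
      rw [Real.rpow_neg ht0.le, Real.rpow_two]]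
    rw [div_inv_eq_mul]
    nlinarith [le_refl (x ^ (-2 : ℝ) * Q ^ 3 * R ^ 4)]
  exact max_le_max (max_le_max h1 h2) (max_le_max h3 h4)

/-- **The hypotheses of Theorem 5* descend to the scales `x/t`, `1 ≤ t ≤ x^{ε/6}`** (with `ε/2` in
place of `ε`): if `MN = x`, `x^ε ≤ N ≤ x^{1−ε}`, `Q, R ≥ 1/2` and (12.5) `x^ε T(x,Q,R) < M` hold, then
for `M'' = M/t`, `x'' = x/t = M''N` one has `x''^{ε/2} ≤ N ≤ x''^{1−ε/2}`, `QR < x''` and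
`x''^{ε/2} T(x'',Q,R) < M''`, provided `t³ ≤ x^{ε/2}`. [folklore] -/
theorem thm5_hyp_at_scale {x ε M N Q R t : ℝ} (hx : 1 < x) (hε : 0 < ε) (hMN : M * N = x)
    (hN1 : x ^ ε ≤ N) (hN2 : N ≤ x ^ (1 - ε)) (hQ : 1 / 2 ≤ Q) (hR : 1 / 2 ≤ R)
    (hthr : x ^ ε * thm5Threshold x Q R < M) (ht1 : 1 ≤ t) (ht3 : t ^ 3 ≤ x ^ (ε / 2)) :
    M / t * N = x / t ∧ (x / t) ^ (ε / 2) ≤ N ∧ N ≤ (x / t) ^ (1 - ε / 2) ∧ Q * R < x / t ∧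
      (x / t) ^ (ε / 2) * thm5Threshold (x / t) Q R < M / t := by
  have hx0 : 0 < x := by linarith
  have ht0 : 0 < t := by linarith
  have hε2 := eps_le_half hx hN1 hN2
  have htt : t ≤ t ^ 3 := le_self_pow₀ ht1 (by norm_num)
  have htx : t ≤ x ^ (ε / 2) := htt.trans ht3
  have hxt1 : x ^ (1 - ε / 2) ≤ x / t := by
    rw [Real.rpow_sub hx0, Real.rpow_one]
    exact div_le_div_of_nonneg_left hx0.le ht0 htx
  have hxtx : x / t ≤ x := div_le_self hx0.le ht1
  have hxt0 : 0 < x / t := div_pos hx0 ht0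
  have hxtone : 1 ≤ x / t := le_trans (Real.one_le_rpow hx.le (by linarith)) hxt1
  obtain ⟨hQR, -, -⟩ := QR_lt_of_thm5Threshold hx hMN hN1 hQ (by linarith) hthr
  refine ⟨by rw [← hMN]; ring, ?_, ?_, ?_, ?_⟩
  · calc (x / t) ^ (ε / 2) ≤ x ^ (ε / 2) := Real.rpow_le_rpow hxt0.le hxtx (by linarith)
      _ ≤ x ^ ε := Real.rpow_le_rpow_of_exponent_le hx.le (by linarith)
      _ ≤ N := hN1
  · calc N ≤ x ^ (1 - ε) := hN2
      _ ≤ x ^ ((1 - ε / 2) * (1 - ε / 2)) := Real.rpow_le_rpow_of_exponent_le hx.le (by nlinarith)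
      _ = (x ^ (1 - ε / 2)) ^ (1 - ε / 2) := by rw [Real.rpow_mul hx0.le]
      _ ≤ (x / t) ^ (1 - ε / 2) := Real.rpow_le_rpow (by positivity) hxt1 (by linarith)
  · calc Q * R < x ^ (1 - ε) := hQR
      _ ≤ x ^ (1 - ε / 2) := Real.rpow_le_rpow_of_exponent_le hx.le (by linarith)
      _ ≤ x / t := hxt1
  · have hT0 : 0 ≤ thm5Threshold (x / t) Q R :=
      le_trans (by linarith) (le_trans (le_max_left _ _) (le_max_left _ _))
    have hTt := thm5Threshold_div_le (Q := Q) (R := R) hx0 ht1 (by linarith) (by linarith)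
    have hxe : 0 < x ^ (ε / 2) := Real.rpow_pos_of_pos hx0 _
    calc (x / t) ^ (ε / 2) * thm5Threshold (x / t) Q R
        ≤ x ^ (ε / 2) * (t ^ 2 * thm5Threshold x Q R) :=
          mul_le_mul (Real.rpow_le_rpow hxt0.le hxtx (by linarith)) hTt hT0 hxe.le
      _ = (t ^ 2 * (x ^ (ε / 2))⁻¹) * (x ^ ε * thm5Threshold x Q R) := by
          rw [show x ^ ε = x ^ (ε / 2) * x ^ (ε / 2) by rw [← Real.rpow_add hx0]; ring_nf]
          field_simp
      _ < (t ^ 2 * (x ^ (ε / 2))⁻¹) * M := mul_lt_mul_of_pos_left hthr (by positivity)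
      _ ≤ M / t := by
          -- `t² x^{-ε/2} M ≤ M/t` iff `t³ ≤ x^{ε/2}` (`M > 0`)
          have hM0 : 0 < M := by
            refine lt_of_le_of_lt (mul_nonneg (Real.rpow_nonneg hx0.le _) ?_) hthr
            exact le_trans (by linarith) (le_trans (le_max_left _ _) (le_max_left _ _))
          rw [le_div_iff₀ ht0]
          have h1 : t ^ 2 * (x ^ (ε / 2))⁻¹ * M * t = (t ^ 3 / x ^ (ε / 2)) * M := by ring
          rw [h1]
          calc t ^ 3 / x ^ (ε / 2) * M ≤ 1 * M :=
                mul_le_mul_of_nonneg_right (by rw [div_le_one hxe]; exact ht3) hM0.le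
            _ = M := one_mul M

/-- **The sifting range at the lower scales.**  For `D ≥ 0`, `log x ≥ 4(D+2)²` and
`x/(2 (log x)^D) ≤ x'`: `exp(log x / log log x − (D+1)) ≤ exp(log x' / log log x')`, i.e.
`e^{−(D+1)} z₀(x) ≤ z₀(x')`. [folklore] -/
theorem exp_div_loglog_sub_le {x x' D : ℝ} (hD : 0 ≤ D) (hx : 0 < x) (hL : 4 * (D + 2) ^ 2 ≤ Real.log x)
    (hx' : x / (2 * Real.log x ^ D) ≤ x') :
    Real.exp (Real.log x / Real.log (Real.log x) - (D + 1)) ≤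
      Real.exp (Real.log x' / Real.log (Real.log x')) := by
  set L : ℝ := Real.log x with hLdef
  have hL16 : 16 ≤ L := le_trans (by nlinarith) hL
  have hL0 : 0 < L := by linarith
  have hLD : 0 < 2 * L ^ D := by positivity
  have hx'0 : 0 < x' := lt_of_lt_of_le (div_pos hx hLD) hx'
  -- `L₁ = L - log 2 - D log L ≤ log x'`
  set L₁ : ℝ := L - Real.log 2 - D * Real.log L with hL₁
  have hL₁le : L₁ ≤ Real.log x' := by
    have h := Real.log_le_log (div_pos hx hLD) hx'
    rw [Real.log_div hx.ne' hLD.ne', Real.log_mul (by norm_num) (by positivity),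
      Real.log_rpow hL0] at h
    linarith
  -- `L₁ ≥ L/2 - 1 ≥ 7`
  have hsqrt : 2 * (D + 2) ≤ Real.sqrt L := Real.le_sqrt_of_sq_le (by nlinarith)
  have hlogL : Real.log L ≤ Real.sqrt L := log_le_sqrt hL0
  have hsq : Real.sqrt L * Real.sqrt L = L := Real.mul_self_sqrt hL0.le
  have hDlog : D * Real.log L ≤ L / 2 := by
    have h1 : D * Real.log L ≤ D * Real.sqrt L := mul_le_mul_of_nonneg_left hlogL hD
    have h2 : D * Real.sqrt L * (2 * (D + 2)) ≤ D * Real.sqrt L * Real.sqrt L :=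
      mul_le_mul_of_nonneg_left hsqrt (by positivity)
    nlinarith
  have hlog2 : Real.log 2 < 1 := by
    have := Real.log_two_lt_d9; linarith
  have hL₁7 : 7 ≤ L₁ := by rw [hL₁]; linarith
  have he : Real.exp 1 ≤ L₁ := le_trans (by have := Real.exp_one_lt_d9; linarith) hL₁7
  have hL₁L : L₁ ≤ L := by
    rw [hL₁]
    have : 0 ≤ Real.log L := Real.log_nonneg (by linarith)
    have : 0 < Real.log 2 := Real.log_pos one_lt_two
    nlinarith
  -- monotonicity of `v / log v`
  have hmono := div_log_mono he hL₁le
  have hlogL2 : Real.log 2 ≤ Real.log L := Real.log_le_log (by norm_num) (by linarith)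
  have hlogLpos : 0 < Real.log L := (Real.log_pos one_lt_two).trans_le hlogL2
  have hlogL₁ : 0 < Real.log L₁ := Real.log_pos (by linarith)
  have hlogL₁L : Real.log L₁ ≤ Real.log L := Real.log_le_log (by linarith) hL₁L
  rw [Real.exp_le_exp]
  calc L / Real.log L - (D + 1) ≤ L / Real.log L - Real.log 2 / Real.log L - D := by
        have : Real.log 2 / Real.log L ≤ 1 := by rw [div_le_one hlogLpos]; exact hlogL2
        linarith
    _ = L₁ / Real.log L := by rw [hL₁]; field_simp
    _ ≤ L₁ / Real.log L₁ := div_le_div_of_nonneg_left (by linarith) hlogL₁ hlogL₁L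
    _ ≤ Real.log x' / Real.log (Real.log x') := hmono

/-- The large-`x` facts used in the reduction (one existential witness). [folklore] -/
theorem interval_eventually (a : ℤ) {ε : ℝ} (hε : 0 < ε) {D : ℝ} (hD : 0 ≤ D) (x₅ y₀ : ℝ) :
    ∃ x₀ : ℝ, ∀ x : ℝ, x₀ ≤ x →
      3 ≤ x ∧ 4 * (D + 2) ^ 2 ≤ Real.log x ∧ x₅ ≤ x ^ (1 / 2 : ℝ) ∧ y₀ ≤ x ^ (1 / 2 : ℝ) ∧
        (2 * Real.log x ^ D) ^ 3 ≤ x ^ (ε / 2) ∧ (2 : ℝ) ≤ x ^ (ε / 4) ∧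
        2 * (|a| : ℝ) + 2 ≤ x ^ (ε / 2) := by
  obtain ⟨x₁, hx₁⟩ := exists_polylog_le_rpow (show (0 : ℝ) ≤ 8 by norm_num)
    (show (0 : ℝ) ≤ 3 * D by positivity) (half_pos hε)
  have h1 : ∀ᶠ x : ℝ in Filter.atTop, 3 ≤ x := Filter.eventually_ge_atTop 3
  have h2 : ∀ᶠ x : ℝ in Filter.atTop, 4 * (D + 2) ^ 2 ≤ Real.log x :=
    Real.tendsto_log_atTop.eventually_ge_atTop _
  have h3 : ∀ᶠ x : ℝ in Filter.atTop, x₅ ≤ x ^ (1 / 2 : ℝ) :=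
    (tendsto_rpow_atTop (by norm_num)).eventually_ge_atTop _
  have h4 : ∀ᶠ x : ℝ in Filter.atTop, y₀ ≤ x ^ (1 / 2 : ℝ) :=
    (tendsto_rpow_atTop (by norm_num)).eventually_ge_atTop _
  have h5 : ∀ᶠ x : ℝ in Filter.atTop, (2 * Real.log x ^ D) ^ 3 ≤ x ^ (ε / 2) := by
    filter_upwards [Filter.eventually_ge_atTop x₁, Filter.eventually_ge_atTop 1] with x hx hx1
    have hL : 0 ≤ Real.log x := Real.log_nonneg hx1
    calc (2 * Real.log x ^ D) ^ 3 = 8 * (Real.log x ^ D) ^ (3 : ℕ) := by ring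
      _ = 8 * Real.log x ^ (3 * D) := by
          rw [← Real.rpow_natCast (Real.log x ^ D), ← Real.rpow_mul hL]; push_cast; ring_nf
      _ ≤ 8 * (4 * Real.log x) ^ (3 * D) :=
          mul_le_mul_of_nonneg_left (Real.rpow_le_rpow hL (by linarith) (by positivity)) (by norm_num)
      _ ≤ x ^ (ε / 2) := hx₁ x hx
  have h6 : ∀ᶠ x : ℝ in Filter.atTop, (2 : ℝ) ≤ x ^ (ε / 4) :=
    (tendsto_rpow_atTop (by positivity)).eventually_ge_atTop _
  have h7 : ∀ᶠ x : ℝ in Filter.atTop, 2 * (|a| : ℝ) + 2 ≤ x ^ (ε / 2) :=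
    (tendsto_rpow_atTop (by positivity)).eventually_ge_atTop _
  obtain ⟨x₀, hx₀⟩ := Filter.eventually_atTop.1 ((h1.and h2).and ((h3.and h4).and ((h5.and h6).and h7)))
  refine ⟨x₀, fun x hx => ?_⟩
  obtain ⟨⟨a1, a2⟩, ⟨a3, a4⟩, ⟨a5, a6⟩, a7⟩ := hx₀ x hx
  exact ⟨a1, a2, a3, a4, a5, a6, a7⟩

end BFI

open BFI

set_option maxHeartbeats 1600000 in
/-- **Theorem 5* on boxes, from the printed Theorem 5*, for `z ≤ e^{−K} z₀(x)`.**
The applied form `Literature.NumberTheory.Sieve.BombieriFriedlanderIwaniecTheorem5StarInterval`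
of Theorem 5* (coefficients (A₆*) restricted to a box `(M₁, M₂]`, §15 p. 246) FOLLOWS from the
printed Theorem 5* (`Literature.NumberTheory.Sieve.BombieriFriedlanderIwaniecTheorem5Star`, §12
p. 238: (A₆*) on the whole range `m ∼ M`) for every sifting range `z ≤ exp(log x/log log x − K)`,
`K = K(a, ε, A, B)` — in particular for the `z = exp(√log x)` of (15.4) used in §§15–17
(`…Theorem5Star.intervalSqrt`).  PROVED here, by an argument not in the source: writing
`𝒟 = ∑_m α_m F(m)` (`BFI.dispD_eq_sum_rowF`), a box `(M, P] ⊆ (M, 2M]` telescopes DOWNWARDS into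
full dyadic ranges, `∑_{(M,P]} = ∑_{j<k} (∑_{(P/2^{j+1}, P/2^j]} − ∑_{(M/2^{j+1}, M/2^j]}) + ∑_{(M/2^k, P/2^k]}`
(`BFI.boxSum_telescope`); each full range at scale `M'' ∈ [M/2^{j+1}, M/2^j]` is a `𝒟` with the
coefficients (A₆*) at `x'' = M''N = x/t`, `t ≤ 2^k`, where the hypotheses of Theorem 5* (with `ε/2`)
still hold (`BFI.thm5_hyp_at_scale`, `BFI.exp_div_loglog_sub_le` — the latter is where `z ≤ z₀(x'')`
costs the factor `e^{−K}`), and its bound `C‖β‖ x''^{1/2} M''^{1/2} ℒ''^{−A} ≤ C 2^A ‖β‖ x^{1/2} M^{1/2} ℒ^{−A} 2^{−j}`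
sums to `≪ ‖β‖ x^{1/2} M^{1/2} ℒ^{−A}`; the last box, at scale `M/2^k` with `2^k ≍ ℒ^{A+c}`, is
bounded trivially by BFI Lemma 3 (`BFI.abs_boxSum_rowF_le`): `≪ ‖β‖ N^{1/2} (M/2^k) ℒ^{c} ≤ ‖β‖ x^{1/2} M^{1/2} ℒ^{−A}`.
(The full range `z ≤ z₀(x)` of `…Theorem5StarInterval` is NOT obtained this way: the scales
`x'' < x` only admit `z ≤ z₀(x'') = z₀(x) e^{−O(A+c)}`.)
[cite: BombieriFriedlanderIwaniecActa1986, §12 Theorem 5* p. 238; §15 (15.4) p. 244, p. 246] -/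
theorem BombieriFriedlanderIwaniecTheorem5Star.interval (h5 : BombieriFriedlanderIwaniecTheorem5Star) :
    ∀ a : ℤ, a ≠ 0 → ∀ ε : ℝ, 0 < ε → ∀ A : ℝ, 0 < A → ∀ B : ℝ, 0 ≤ B →
    ∃ K C x₀ : ℝ, ∀ x : ℝ, x₀ ≤ x → ∀ M N Q R : ℝ,
      M * N = x → x ^ ε ≤ N → N ≤ x ^ (1 - ε) →
      1 / 2 ≤ Q → 1 / 2 ≤ R → Q * R < x →
      x ^ ε * thm5Threshold x Q R < M →
      ∀ z : ℝ, z ≤ Real.exp (Real.log x / Real.log (Real.log x) - K) →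
      ∀ M₁ M₂ : ℝ,
      ∀ β γ δ : ℕ → ℝ, (∀ q, |γ q| ≤ (σ 0 q : ℝ) ^ B) → (∀ r, |δ r| ≤ (σ 0 r : ℝ) ^ B) →
        |dispD a M N Q R
            (fun m => if M₁ < (m : ℝ) ∧ (m : ℝ) ≤ M₂ then roughIndicator z m else 0) β γ δ| ≤
          C * Real.sqrt (l2Sq N β) * x ^ (1 / 2 : ℝ) * M ^ (1 / 2 : ℝ) / Real.log x ^ A := by
  intro a ha ε hε A hA B hB
  obtain ⟨C₅, x₅, h5'⟩ := h5 a ha (ε / 2) (half_pos hε) A hA B hB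
  obtain ⟨Ct, c, y₀, hCt, hc, ht⟩ := abs_boxSum_rowF_le ha ⌈B⌉₊ (ε₃ := ε / 4) (by positivity)
  set D : ℝ := A + c with hDdef
  have hD0 : 0 ≤ D := by positivity
  obtain ⟨x₀, hx₀⟩ := interval_eventually a hε hD0 (max x₅ 1) (max y₀ 1)
  refine ⟨D + 1, 2 * (4 * max C₅ 0 * 2 ^ A + Ct), x₀,
    fun x hx M N Q R hMN hN1 hN2 hQ hR _hQR hthr z hz M₁ M₂ β γ δ hγ hδ => ?_⟩
  obtain ⟨hx3, hLD, hx₅, hy₀, hT3, hx4, hxa⟩ := hx₀ x hx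
  -- basic facts
  have hx0 : 0 < x := by linarith
  have hx1 : 1 < x := by linarith
  set L : ℝ := Real.log x with hLdef
  have hL16 : 16 ≤ L := le_trans (by nlinarith) hLD
  have hL1 : 1 ≤ L := by linarith
  have hL0 : 0 < L := by linarith
  have hε2 : ε ≤ 1 / 2 := eps_le_half hx1 hN1 hN2
  have hxε : 0 < x ^ ε := Real.rpow_pos_of_pos hx0 ε
  have hN0 : 0 < N := hxε.trans_le hN1
  have hN1' : 1 ≤ N := le_trans (Real.one_le_rpow hx1.le hε.le) hN1
  have hTQ : Q ≤ thm5Threshold x Q R := le_trans (le_max_left _ _) (le_max_left _ _)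
  have hM0 : 0 < M := by
    refine lt_of_le_of_lt (mul_nonneg hxε.le (le_trans (by linarith) hTQ)) hthr
  have hMx : M = x / N := by field_simp; linarith
  obtain ⟨-, hQx, hRx⟩ := QR_lt_of_thm5Threshold hx1 hMN hN1 hQ (by linarith) hthr
  have hx12 : x ^ (1 / 2 : ℝ) * x ^ (1 / 2 : ℝ) = x := by
    rw [← Real.rpow_add hx0]; norm_num
  have hsqrt : N ^ (1 / 2 : ℝ) * M = x ^ (1 / 2 : ℝ) * M ^ (1 / 2 : ℝ) := by
    have hM12 : M ^ (1 / 2 : ℝ) * M ^ (1 / 2 : ℝ) = M := by rw [← Real.rpow_add hM0]; norm_num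
    calc N ^ (1 / 2 : ℝ) * M = N ^ (1 / 2 : ℝ) * (M ^ (1 / 2 : ℝ) * M ^ (1 / 2 : ℝ)) := by rw [hM12]
      _ = (N * M) ^ (1 / 2 : ℝ) * M ^ (1 / 2 : ℝ) := by rw [Real.mul_rpow hN0.le hM0.le]; ring
      _ = x ^ (1 / 2 : ℝ) * M ^ (1 / 2 : ℝ) := by rw [mul_comm N M, hMN]
  -- the depth `k`: `L^D < 2^k ≤ 2 L^D`
  set T : ℝ := L ^ D with hTdef
  have hT1 : 1 ≤ T := Real.one_le_rpow hL1 hD0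
  obtain ⟨k, hk1, hk2⟩ := exists_pow_two_near hT1
  have h2k0 : (0 : ℝ) < 2 ^ k := by positivity
  have h2k3 : ((2 : ℝ) ^ k) ^ 3 ≤ x ^ (ε / 2) := le_trans (pow_le_pow_left₀ h2k0.le hk2 3) hT3
  have h2k : (2 : ℝ) ^ k ≤ x ^ (ε / 2) := le_trans (le_self_pow₀ (one_le_pow₀ (by norm_num)) (by norm_num)) h2k3
  have hx2k : x ^ (1 - ε / 2) ≤ x / 2 ^ k := by
    rw [Real.rpow_sub hx0, Real.rpow_one]
    exact div_le_div_of_nonneg_left hx0.le h2k0 h2k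
  have hxhalf : x ^ (1 / 2 : ℝ) ≤ x ^ (1 - ε / 2) := Real.rpow_le_rpow_of_exponent_le hx1.le (by linarith)
  -- `u = M/2^k ≥ |a| + 1`
  have hu1 : (|a| : ℝ) + 1 ≤ M / 2 ^ k := by
    rw [le_div_iff₀ h2k0]
    have h1 : x ^ ε * Q < M := lt_of_le_of_lt (mul_le_mul_of_nonneg_left hTQ hxε.le) hthr
    have h2 : x ^ ε = x ^ (ε / 2) * x ^ (ε / 2) := by rw [← Real.rpow_add hx0]; ring_nf
    nlinarith [mul_le_mul hxa h2k (h2k0.le) (Real.rpow_nonneg hx0.le _)]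
  -- the clamp and the box function
  rw [dispD_box_clamp a hM0.le]
  obtain ⟨hMu, huv, hv⟩ := clamp_bounds hM0.le M₁ M₂
  set u₀ : ℝ := max M (min M₁ (2 * M)) with hu₀
  set v₀ : ℝ := max u₀ (min M₂ (2 * M)) with hv₀
  rw [dispD_box_eq_boxSum a hM0.le hMu huv hv]
  obtain ⟨g, hg⟩ : ∃ g : ℕ → ℝ, g = fun m => roughIndicator z m * rowF a N Q R β γ δ m := ⟨_, rfl⟩
  rw [← hg]
  have hγ' := abs_le_sigma_pow_ceil hB hγ
  have hδ' := abs_le_sigma_pow_ceil hB hδ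
  -- the main quantity
  set W : ℝ := Real.sqrt (l2Sq N β) * x ^ (1 / 2 : ℝ) * M ^ (1 / 2 : ℝ) / L ^ A with hWdef
  have hW0 : 0 ≤ W := by positivity
  set c₀ : ℝ := max C₅ 0 * 2 ^ A * W with hc₀
  have hc₀0 : 0 ≤ c₀ := by positivity
  -- (1) the dyadic pieces, from Theorem 5* at the scale `x/t`, `t = M/M'' ∈ [2^j, 2^{j+1}]`
  have hpiece : ∀ (j : ℕ) (M'' : ℝ), j < k → M / 2 ^ (j + 1) ≤ M'' → M'' ≤ M / 2 ^ j →
      |dispD a M'' N Q R (roughIndicator z) β γ δ| ≤ c₀ / 2 ^ j := by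
    intro j M'' hjk hM''1 hM''2
    have h2j : (0 : ℝ) < 2 ^ j := by positivity
    have hM''0 : 0 < M'' := lt_of_lt_of_le (by positivity) hM''1
    set t : ℝ := M / M'' with htdef
    have ht0 : 0 < t := div_pos hM0 hM''0
    have htj : (2 : ℝ) ^ j ≤ t := by
      rw [htdef, le_div_iff₀ hM''0]
      calc (2 : ℝ) ^ j * M'' ≤ 2 ^ j * (M / 2 ^ j) := mul_le_mul_of_nonneg_left hM''2 h2j.le
        _ = M := by field_simp
    have htj1 : t ≤ 2 ^ (j + 1) := by
      rw [htdef, div_le_iff₀ hM''0]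
      calc M = 2 ^ (j + 1) * (M / 2 ^ (j + 1)) := by field_simp
        _ ≤ 2 ^ (j + 1) * M'' := mul_le_mul_of_nonneg_left hM''1 (by positivity)
    have ht1 : 1 ≤ t := le_trans (one_le_pow₀ (by norm_num)) htj
    have htk : t ≤ 2 ^ k := htj1.trans (pow_le_pow_right₀ (by norm_num) hjk)
    have ht3 : t ^ 3 ≤ x ^ (ε / 2) := le_trans (pow_le_pow_left₀ ht0.le htk 3) h2k3
    obtain ⟨hMN'', hN1'', hN2'', hQR'', hthr''⟩ := thm5_hyp_at_scale hx1 hε hMN hN1 hN2 hQ hR hthr ht1 ht3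
    have hMt : M / t = M'' := by rw [htdef]; field_simp
    have hxtk : x / 2 ^ k ≤ x / t := div_le_div_of_nonneg_left hx0.le ht0 htk
    have hxt12 : x ^ (1 / 2 : ℝ) ≤ x / t := hxhalf.trans (hx2k.trans hxtk)
    have hxt0 : 0 < x / t := div_pos hx0 ht0
    have hx₅' : x₅ ≤ x / t := le_trans (le_max_left _ _) (hx₅.trans hxt12)
    have hz' : z ≤ Real.exp (Real.log (x / t) / Real.log (Real.log (x / t))) := by
      refine hz.trans (exp_div_loglog_sub_le hD0 hx0 hLD ?_)
      exact div_le_div_of_nonneg_left hx0.le ht0 (htk.trans hk2)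
    have h := h5' (x / t) hx₅' (M / t) N Q R hMN'' hN1'' hN2'' hQ hR hQR'' hthr'' z hz' β γ δ hγ hδ
    rw [← hMt]
    refine h.trans ?_
    -- the size of the bound at the scale `x/t`
    have hlogt : L / 2 ≤ Real.log (x / t) := by
      have h1 := Real.log_le_log (by positivity) hxt12
      rw [Real.log_rpow hx0] at h1
      linarith
    have hlogt0 : 0 < Real.log (x / t) := by linarith
    have hLA : L ^ A / 2 ^ A ≤ Real.log (x / t) ^ A := by
      rw [← Real.div_rpow hL0.le (by norm_num)]
      exact Real.rpow_le_rpow (by positivity) hlogt hA.le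
    have hprod : (x / t) ^ (1 / 2 : ℝ) * (M / t) ^ (1 / 2 : ℝ) = x ^ (1 / 2 : ℝ) * M ^ (1 / 2 : ℝ) / t := by
      rw [Real.div_rpow hx0.le ht0.le, Real.div_rpow hM0.le ht0.le, div_mul_div_comm,
        ← Real.rpow_add ht0]
      norm_num
    have hS0 : 0 ≤ Real.sqrt (l2Sq N β) * (x / t) ^ (1 / 2 : ℝ) * (M / t) ^ (1 / 2 : ℝ) /
        Real.log (x / t) ^ A := by positivity
    calc C₅ * Real.sqrt (l2Sq N β) * (x / t) ^ (1 / 2 : ℝ) * (M / t) ^ (1 / 2 : ℝ) / Real.log (x / t) ^ A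
        = C₅ * (Real.sqrt (l2Sq N β) * (x / t) ^ (1 / 2 : ℝ) * (M / t) ^ (1 / 2 : ℝ) /
            Real.log (x / t) ^ A) := by ring
      _ ≤ max C₅ 0 * (Real.sqrt (l2Sq N β) * (x / t) ^ (1 / 2 : ℝ) * (M / t) ^ (1 / 2 : ℝ) /
            Real.log (x / t) ^ A) := mul_le_mul_of_nonneg_right (le_max_left _ _) hS0
      _ = max C₅ 0 * (Real.sqrt (l2Sq N β) * (x ^ (1 / 2 : ℝ) * M ^ (1 / 2 : ℝ)) *
            (t⁻¹ / Real.log (x / t) ^ A)) := by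
          rw [mul_assoc (Real.sqrt (l2Sq N β)), hprod]; ring
      _ ≤ max C₅ 0 * (Real.sqrt (l2Sq N β) * (x ^ (1 / 2 : ℝ) * M ^ (1 / 2 : ℝ)) *
            ((2 ^ j)⁻¹ / (L ^ A / 2 ^ A))) := by
          refine mul_le_mul_of_nonneg_left (mul_le_mul_of_nonneg_left ?_ (by positivity)) (le_max_right _ _)
          exact div_le_div₀ (by positivity) (inv_anti₀ h2j htj) (by positivity) hLA
      _ = c₀ / 2 ^ j := by
          rw [hc₀, hWdef, div_div_eq_mul_div]; ring
  -- (2) one `P`-box `(M, P]`, `M ≤ P ≤ 2M`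
  have hPbox : ∀ P : ℝ, M ≤ P → P ≤ 2 * M → |boxSum g M P| ≤ (4 * max C₅ 0 * 2 ^ A + Ct) * W := by
    intro P hMP hP2
    have hP0 : 0 < P := hM0.trans_le hMP
    rw [boxSum_telescope g hM0.le hMP hP2 k]
    -- the dyadic pieces
    have hdy : |∑ j ∈ Finset.range k,
        (boxSum g (P / 2 ^ (j + 1)) (P / 2 ^ j) - boxSum g (M / 2 ^ (j + 1)) (M / 2 ^ j))| ≤ 4 * c₀ := by
      have hterm : ∀ j ∈ Finset.range k,
          |boxSum g (P / 2 ^ (j + 1)) (P / 2 ^ j) - boxSum g (M / 2 ^ (j + 1)) (M / 2 ^ j)| ≤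
            2 * c₀ * (1 / 2) ^ j := by
        intro j hj
        rw [Finset.mem_range] at hj
        have e2 : ∀ Y : ℝ, Y / 2 ^ j = 2 * (Y / 2 ^ (j + 1)) := fun Y => by
          rw [pow_succ]; field_simp
        have eP : boxSum g (P / 2 ^ (j + 1)) (P / 2 ^ j) =
            dispD a (P / 2 ^ (j + 1)) N Q R (roughIndicator z) β γ δ := by
          rw [e2 P, dispD_rough_eq_boxSum a (by positivity), hg]
        have eM : boxSum g (M / 2 ^ (j + 1)) (M / 2 ^ j) =
            dispD a (M / 2 ^ (j + 1)) N Q R (roughIndicator z) β γ δ := by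
          rw [e2 M, dispD_rough_eq_boxSum a (by positivity), hg]
        have hP1 : P / 2 ^ (j + 1) ≤ M / 2 ^ j :=
          calc P / 2 ^ (j + 1) = (P / 2) / 2 ^ j := by rw [pow_succ]; ring
            _ ≤ M / 2 ^ j := div_le_div_of_nonneg_right (by linarith) (by positivity)
        have h1 := hpiece j (P / 2 ^ (j + 1)) hj (div_le_div_of_nonneg_right hMP (by positivity)) hP1
        have hM1 : M / 2 ^ (j + 1) ≤ M / 2 ^ j :=
          calc M / 2 ^ (j + 1) = (M / 2) / 2 ^ j := by rw [pow_succ]; ring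
            _ ≤ M / 2 ^ j := div_le_div_of_nonneg_right (by linarith) (by positivity)
        have h2 := hpiece j (M / 2 ^ (j + 1)) hj le_rfl hM1
        rw [eP, eM]
        calc |dispD a (P / 2 ^ (j + 1)) N Q R (roughIndicator z) β γ δ -
              dispD a (M / 2 ^ (j + 1)) N Q R (roughIndicator z) β γ δ|
            ≤ |dispD a (P / 2 ^ (j + 1)) N Q R (roughIndicator z) β γ δ| +
              |dispD a (M / 2 ^ (j + 1)) N Q R (roughIndicator z) β γ δ| := abs_sub _ _
          _ ≤ c₀ / 2 ^ j + c₀ / 2 ^ j := add_le_add h1 h2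
          _ = 2 * c₀ * (1 / 2) ^ j := by rw [one_div, inv_pow]; ring
      calc |∑ j ∈ Finset.range k,
            (boxSum g (P / 2 ^ (j + 1)) (P / 2 ^ j) - boxSum g (M / 2 ^ (j + 1)) (M / 2 ^ j))|
          ≤ ∑ j ∈ Finset.range k,
            |boxSum g (P / 2 ^ (j + 1)) (P / 2 ^ j) - boxSum g (M / 2 ^ (j + 1)) (M / 2 ^ j)| :=
            Finset.abs_sum_le_sum_abs _ _
        _ ≤ ∑ j ∈ Finset.range k, 2 * c₀ * (1 / 2 : ℝ) ^ j := Finset.sum_le_sum hterm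
        _ = 2 * c₀ * ∑ j ∈ Finset.range k, (1 / 2 : ℝ) ^ j := by rw [Finset.mul_sum]
        _ ≤ 2 * c₀ * 2 := mul_le_mul_of_nonneg_left (sum_geometric_two_le k) (by positivity)
        _ = 4 * c₀ := by ring
    -- the remainder box at scale `M/2^k`, bounded trivially
    have hrem : |boxSum g (M / 2 ^ k) (P / 2 ^ k)| ≤ Ct * W := by
      set u : ℝ := M / 2 ^ k with hudef
      have hu1' : 1 ≤ u := le_trans (by linarith [abs_nonneg (a : ℝ)]) hu1
      have hau : (|a| : ℝ) < u := lt_of_lt_of_le (by linarith) hu1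
      have huv' : u ≤ P / 2 ^ k := div_le_div_of_nonneg_right hMP h2k0.le
      have hvu' : P / 2 ^ k ≤ 2 * u := by
        rw [hudef, mul_div_assoc']
        exact div_le_div_of_nonneg_right hP2 h2k0.le
      have huN : u * N = x / 2 ^ k := by rw [hudef, ← hMN]; ring
      have huNx : u * N ≤ x := by rw [huN]; exact div_le_self hx0.le (one_le_pow₀ (by norm_num))
      have h4uN : x ^ (1 - ε / 2) ≤ 4 * u * N := by
        rw [mul_assoc, huN]
        exact hx2k.trans (by linarith [div_pos hx0 h2k0])
      have hy : y₀ ≤ 4 * u * N :=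
        le_trans (le_max_left _ _) (hy₀.trans (hxhalf.trans h4uN))
      have hNy : 2 * N ≤ (4 * u * N) ^ (1 - ε / 4) := by
        calc 2 * N ≤ x ^ (ε / 4) * x ^ (1 - ε) := mul_le_mul hx4 hN2 hN0.le (by positivity)
          _ = x ^ (1 - 3 * ε / 4) := by rw [← Real.rpow_add hx0]; ring_nf
          _ ≤ x ^ ((1 - ε / 2) * (1 - ε / 4)) := Real.rpow_le_rpow_of_exponent_le hx1.le (by nlinarith)
          _ = (x ^ (1 - ε / 2)) ^ (1 - ε / 4) := by rw [Real.rpow_mul hx0.le]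
          _ ≤ (4 * u * N) ^ (1 - ε / 4) := Real.rpow_le_rpow (by positivity) h4uN (by linarith)
      have hQx2 : Q ≤ x ^ 2 := by
        have : x ^ (1 - 2 * ε) ≤ x := by
          calc x ^ (1 - 2 * ε) ≤ x ^ (1 : ℝ) := Real.rpow_le_rpow_of_exponent_le hx1.le (by linarith)
            _ = x := Real.rpow_one x
        nlinarith
      have hRx2 : R ≤ x ^ 2 := by
        have : x ^ (1 - 2 * ε) ≤ x := by
          calc x ^ (1 - 2 * ε) ≤ x ^ (1 : ℝ) := Real.rpow_le_rpow_of_exponent_le hx1.le (by linarith)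
            _ = x := Real.rpow_one x
        nlinarith
      have h := ht x u (P / 2 ^ k) N Q R (roughIndicator z) β γ δ hx3 hy hu1' huv' hvu' hN1' huNx hau
        hNy (by linarith) hQx2 (by linarith) hRx2 (abs_roughIndicator_le_one z) hγ' hδ'
      rw [hg]
      refine h.trans ?_
      -- `Ct ‖β‖ N^{1/2} (M/2^k) L^c ≤ Ct ‖β‖ x^{1/2} M^{1/2} / L^A` as `2^k > L^{A+c}`
      have hLc : L ^ c / 2 ^ k ≤ (L ^ A)⁻¹ := by
        rw [div_le_iff₀ h2k0]
        have hT' : L ^ D = L ^ A * L ^ c := by rw [hDdef, Real.rpow_add hL0]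
        calc L ^ c = (L ^ A)⁻¹ * L ^ D := by rw [hT']; field_simp
          _ ≤ (L ^ A)⁻¹ * 2 ^ k := mul_le_mul_of_nonneg_left hk1.le (by positivity)
      calc Ct * Real.sqrt (l2Sq N β) * N ^ (1 / 2 : ℝ) * u * L ^ c
          = Ct * Real.sqrt (l2Sq N β) * (N ^ (1 / 2 : ℝ) * M) * (L ^ c / 2 ^ k) := by
            rw [hudef]; ring
        _ ≤ Ct * Real.sqrt (l2Sq N β) * (N ^ (1 / 2 : ℝ) * M) * (L ^ A)⁻¹ :=
            mul_le_mul_of_nonneg_left hLc (by positivity)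
        _ = Ct * W := by rw [hsqrt, hWdef]; ring
    calc |(∑ j ∈ Finset.range k,
          (boxSum g (P / 2 ^ (j + 1)) (P / 2 ^ j) - boxSum g (M / 2 ^ (j + 1)) (M / 2 ^ j))) +
          boxSum g (M / 2 ^ k) (P / 2 ^ k)|
        ≤ |∑ j ∈ Finset.range k,
          (boxSum g (P / 2 ^ (j + 1)) (P / 2 ^ j) - boxSum g (M / 2 ^ (j + 1)) (M / 2 ^ j))| +
          |boxSum g (M / 2 ^ k) (P / 2 ^ k)| := abs_add_le _ _
      _ ≤ 4 * c₀ + Ct * W := add_le_add hdy hrem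
      _ = (4 * max C₅ 0 * 2 ^ A + Ct) * W := by rw [hc₀]; ring
  -- (3) conclusion: `(u₀, v₀] = (M, v₀] ∖ (M, u₀]`
  have hsplit : boxSum g u₀ v₀ = boxSum g M v₀ - boxSum g M u₀ := by
    have := boxSum_add g hMu huv; linarith
  rw [hsplit]
  calc |boxSum g M v₀ - boxSum g M u₀| ≤ |boxSum g M v₀| + |boxSum g M u₀| := abs_sub _ _
    _ ≤ (4 * max C₅ 0 * 2 ^ A + Ct) * W + (4 * max C₅ 0 * 2 ^ A + Ct) * W :=
        add_le_add (hPbox v₀ (hMu.trans huv) hv) (hPbox u₀ hMu (huv.trans hv))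
    _ = 2 * (4 * max C₅ 0 * 2 ^ A + Ct) * Real.sqrt (l2Sq N β) * x ^ (1 / 2 : ℝ) * M ^ (1 / 2 : ℝ) /
        Real.log x ^ A := by rw [hWdef]; ring

/-- `√L + K ≤ L / log L` for `L ≥ 256`, `K² ≤ L` (`log L = 4 log L^{1/4} ≤ 2 L^{1/4}`). [folklore] -/
theorem BFI.sqrt_add_le_div_log {L K : ℝ} (hL : 256 ≤ L) (hK : K ^ 2 ≤ L) :
    Real.sqrt L + K ≤ L / Real.log L := by
  have hL0 : 0 < L := by linarith
  set s : ℝ := Real.sqrt L with hs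
  have hss : s * s = L := Real.mul_self_sqrt hL0.le
  have hs16 : 16 ≤ s := by
    rw [hs, show (16 : ℝ) = Real.sqrt (16 ^ 2) by rw [Real.sqrt_sq (by norm_num)]]
    exact Real.sqrt_le_sqrt (by norm_num; linarith)
  have hs0 : 0 < s := by linarith
  set r : ℝ := Real.sqrt s with hr
  have hrr : r * r = s := Real.mul_self_sqrt hs0.le
  have hr4 : 4 ≤ r := by
    rw [hr, show (4 : ℝ) = Real.sqrt (4 ^ 2) by rw [Real.sqrt_sq (by norm_num)]]
    exact Real.sqrt_le_sqrt (by norm_num; linarith)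
  have hr0 : 0 < r := by linarith
  have hKs : K ≤ s := by
    rw [hs]; exact Real.le_sqrt_of_sq_le hK
  -- `log L = 2 log s ≤ 2 √s = 2 r`
  have hlogL : Real.log L ≤ 2 * r := by
    have h1 : Real.log L = 2 * Real.log s := by
      rw [← hss, Real.log_mul hs0.ne' hs0.ne']; ring
    rw [h1]
    linarith [log_le_sqrt hs0]
  have hlogL0 : 0 < Real.log L := Real.log_pos (by linarith)
  rw [le_div_iff₀ hlogL0]
  calc (s + K) * Real.log L ≤ (s + s) * (2 * r) :=
        mul_le_mul (by linarith) hlogL hlogL0.le (by linarith)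
    _ = 4 * (s * r) := by ring
    _ ≤ r * (s * r) := mul_le_mul_of_nonneg_right hr4 (by positivity)
    _ = L := by rw [← hss, ← hrr]; ring

set_option maxHeartbeats 400000 in
/-- **Theorem 5* on boxes with `z ≤ exp(√log x)`, from the printed Theorem 5*.**  The corollary of
`…Theorem5Star.interval` in the exact shape consumed in §17 (Case B1,
`Literature.NumberTheory.Sieve.BFI.caseB1_bound`, where `z = exp(√log x)` as in (15.4)): the
statement of `Literature.NumberTheory.Sieve.BombieriFriedlanderIwaniecTheorem5StarInterval` verbatim
except that the sifting range `z ≤ exp(log x / log log x)` is replaced by `z ≤ exp(√log x)`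
(`exp(√log x) ≤ e^{−K} z₀(x)` for large `x`, `BFI.sqrt_add_le_div_log`).  PROVED from the named fact
`…Theorem5Star` (the printed Theorem 5*); hence every use of the boxed form with `z = exp(√log x)`
rests on the printed theorem alone.
[cite: BombieriFriedlanderIwaniecActa1986, §12 Theorem 5* p. 238; §15 (15.4) p. 244; §17 p. 249] -/
theorem BombieriFriedlanderIwaniecTheorem5Star.intervalSqrt (h5 : BombieriFriedlanderIwaniecTheorem5Star) :
    ∀ a : ℤ, a ≠ 0 → ∀ ε : ℝ, 0 < ε → ∀ A : ℝ, 0 < A → ∀ B : ℝ, 0 ≤ B →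
    ∃ C x₀ : ℝ, ∀ x : ℝ, x₀ ≤ x → ∀ M N Q R : ℝ,
      M * N = x → x ^ ε ≤ N → N ≤ x ^ (1 - ε) →
      1 / 2 ≤ Q → 1 / 2 ≤ R → Q * R < x →
      x ^ ε * thm5Threshold x Q R < M →
      ∀ z : ℝ, z ≤ Real.exp (Real.sqrt (Real.log x)) →
      ∀ M₁ M₂ : ℝ,
      ∀ β γ δ : ℕ → ℝ, (∀ q, |γ q| ≤ (σ 0 q : ℝ) ^ B) → (∀ r, |δ r| ≤ (σ 0 r : ℝ) ^ B) →
        |dispD a M N Q R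
            (fun m => if M₁ < (m : ℝ) ∧ (m : ℝ) ≤ M₂ then roughIndicator z m else 0) β γ δ| ≤
          C * Real.sqrt (l2Sq N β) * x ^ (1 / 2 : ℝ) * M ^ (1 / 2 : ℝ) / Real.log x ^ A := by
  intro a ha ε hε A hA B hB
  obtain ⟨K, C, x₀, h⟩ := BombieriFriedlanderIwaniecTheorem5Star.interval h5 a ha ε hε A hA B hB
  refine ⟨C, max x₀ (Real.exp (max 256 (max K 0 ^ 2))),
    fun x hx M N Q R hMN hN1 hN2 hQ hR hQR hthr z hz M₁ M₂ β γ δ hγ hδ => ?_⟩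
  have hx₀ : x₀ ≤ x := le_trans (le_max_left _ _) hx
  have hxe : Real.exp (max 256 (max K 0 ^ 2)) ≤ x := le_trans (le_max_right _ _) hx
  have hx0 : 0 < x := (Real.exp_pos _).trans_le hxe
  have hL : max 256 (max K 0 ^ 2) ≤ Real.log x := by rwa [Real.le_log_iff_exp_le hx0]
  refine h x hx₀ M N Q R hMN hN1 hN2 hQ hR hQR hthr z (hz.trans ?_) M₁ M₂ β γ δ hγ hδ
  rw [Real.exp_le_exp]
  have h1 := BFI.sqrt_add_le_div_log (le_trans (le_max_left _ _) hL) (le_trans (le_max_right _ _) hL)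
  linarith [le_max_left K 0]

/-! ### Theorem 5 on boxes, keeping the power saving -/

/-- The large-`x` facts used in the power-saving reduction (one existential witness). [folklore] -/
theorem BFI.interval_eventually_pow (a : ℤ) {ε : ℝ} (hε : 0 < ε) (x₅ y₀ c : ℝ) (hc : 0 ≤ c) :
    ∃ x₀ : ℝ, ∀ x : ℝ, x₀ ≤ x →
      3 ≤ x ∧ x₅ ≤ x ^ (1 / 2 : ℝ) ∧ y₀ ≤ x ^ (1 / 2 : ℝ) ∧ (2 : ℝ) ≤ x ^ (ε / 4) ∧
        2 * (|a| : ℝ) + 2 ≤ x ^ (ε / 24) ∧ Real.log x ^ c ≤ x ^ (ε / 48) := by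
  obtain ⟨x₁, hx₁⟩ := exists_polylog_le_rpow (show (0 : ℝ) ≤ 1 by norm_num) hc
    (show (0 : ℝ) < ε / 48 by positivity)
  have h1 : ∀ᶠ x : ℝ in Filter.atTop, 3 ≤ x := Filter.eventually_ge_atTop 3
  have h3 : ∀ᶠ x : ℝ in Filter.atTop, x₅ ≤ x ^ (1 / 2 : ℝ) :=
    (tendsto_rpow_atTop (by norm_num)).eventually_ge_atTop _
  have h4 : ∀ᶠ x : ℝ in Filter.atTop, y₀ ≤ x ^ (1 / 2 : ℝ) :=
    (tendsto_rpow_atTop (by norm_num)).eventually_ge_atTop _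
  have h6 : ∀ᶠ x : ℝ in Filter.atTop, (2 : ℝ) ≤ x ^ (ε / 4) :=
    (tendsto_rpow_atTop (by positivity)).eventually_ge_atTop _
  have h7 : ∀ᶠ x : ℝ in Filter.atTop, 2 * (|a| : ℝ) + 2 ≤ x ^ (ε / 24) :=
    (tendsto_rpow_atTop (by positivity)).eventually_ge_atTop _
  have h8 : ∀ᶠ x : ℝ in Filter.atTop, Real.log x ^ c ≤ x ^ (ε / 48) := by
    filter_upwards [Filter.eventually_ge_atTop x₁, Filter.eventually_ge_atTop 1] with x hx hx1
    have hL : 0 ≤ Real.log x := Real.log_nonneg hx1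
    calc Real.log x ^ c ≤ (4 * Real.log x) ^ c := Real.rpow_le_rpow hL (by linarith) hc
      _ = 1 * (4 * Real.log x) ^ c := (one_mul _).symm
      _ ≤ x ^ (ε / 48) := hx₁ x hx
  obtain ⟨x₀, hx₀⟩ := Filter.eventually_atTop.1 ((h1.and h3).and ((h4.and h6).and (h7.and h8)))
  refine ⟨x₀, fun x hx => ?_⟩
  obtain ⟨⟨a1, a3⟩, ⟨a4, a6⟩, a7, a8⟩ := hx₀ x hx
  exact ⟨a1, a3, a4, a6, a7, a8⟩

/-- The constant coefficient `1` is the rough indicator at `z = 0`. [folklore] -/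
theorem BFI.roughIndicator_zero_eq_one : roughIndicator 0 = fun _ => (1 : ℝ) :=
  funext fun m => roughIndicator_of_le_two (by norm_num) m

set_option maxHeartbeats 1600000 in
/-- **Theorem 5 on boxes, from the printed Theorem 5 (power saving kept).**  The printed Theorem 5
(`Literature.NumberTheory.Sieve.BombieriFriedlanderIwaniecTheorem5`, §12 p. 237: (A₆) `α ≡ 1` on
`m ∼ M`, conclusion (12.4) `𝒟 ≪ ‖β‖ x^{1/2−ε'} M^{1/2}`) implies the same bound for the coefficients
`α = 1_{(M₁, M₂]}` of an arbitrary box (only `m ∼ M` matter), with a smaller saving exponent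
`ε'' = min(ε', ε/8) > 0`: for `a ≠ 0`, `ε > 0`, `B ≥ 0` there are `ε'' > 0`, `C`, `x₀` such that under
(A₁), `Q, R ≥ 1/2`, `QR < x`, (12.5) and (A₃),
`|𝒟(M,N,Q,R; 1_{(M₁,M₂]}, β, γ, δ)| ≤ C ‖β‖ x^{1/2−ε''} M^{1/2}`.
This is the form in which Theorem 5 enters the proof of Theorem 5* on p. 238 (applied to
`E_d`, i.e. at the scales `M/d`, `d ≤ D = x^{ε}`, where the box structure is essential) and §15.
PROVED by the downward dyadic telescoping of `…Theorem5Star.interval` (no sifting range to track):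
depth `2^k ≍ x^{ε/7}`-ish (`x^{ε/8}·x^{ε/48}`-bookkeeping below), pieces from Theorem 5 at `x/t` with
`ε/2`, last box by the trivial bound `BFI.abs_boxSum_rowF_le`.
[cite: BombieriFriedlanderIwaniecActa1986, §12 Theorem 5 p. 237, p. 238] -/
theorem BombieriFriedlanderIwaniecTheorem5.interval (h5 : BombieriFriedlanderIwaniecTheorem5) :
    ∀ a : ℤ, a ≠ 0 → ∀ ε : ℝ, 0 < ε → ∀ B : ℝ, 0 ≤ B →
    ∃ ε' C x₀ : ℝ, 0 < ε' ∧ ∀ x : ℝ, x₀ ≤ x → ∀ M N Q R : ℝ,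
      M * N = x → x ^ ε ≤ N → N ≤ x ^ (1 - ε) →
      1 / 2 ≤ Q → 1 / 2 ≤ R → Q * R < x →
      x ^ ε * thm5Threshold x Q R < M →
      ∀ M₁ M₂ : ℝ,
      ∀ β γ δ : ℕ → ℝ, (∀ q, |γ q| ≤ (σ 0 q : ℝ) ^ B) → (∀ r, |δ r| ≤ (σ 0 r : ℝ) ^ B) →
        |dispD a M N Q R (fun m => if M₁ < (m : ℝ) ∧ (m : ℝ) ≤ M₂ then 1 else 0) β γ δ| ≤
          C * Real.sqrt (l2Sq N β) * x ^ (1 / 2 - ε') * M ^ (1 / 2 : ℝ) := by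
  intro a ha ε hε B hB
  obtain ⟨ε₅, C₅, x₅, hε₅, h5'⟩ := h5 a ha (ε / 2) (half_pos hε) B hB
  obtain ⟨Ct, c, y₀, hCt, hc, ht⟩ := abs_boxSum_rowF_le ha ⌈B⌉₊ (ε₃ := ε / 4) (by positivity)
  obtain ⟨x₀, hx₀⟩ := BFI.interval_eventually_pow a hε (max x₅ 1) (max y₀ 1) c hc
  -- the saving: `ε'' = min (min ε₅ (1/2)) (ε/48)`
  set ε' : ℝ := min (min ε₅ (1 / 2)) (ε / 48) with hε'def
  have hε'0 : 0 < ε' := lt_min (lt_min hε₅ (by norm_num)) (by positivity)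
  have hε'5 : ε' ≤ ε₅ := (min_le_left _ _).trans (min_le_left _ _)
  have hε'h : ε' ≤ 1 / 2 := (min_le_left _ _).trans (min_le_right _ _)
  have hε'48 : ε' ≤ ε / 48 := min_le_right _ _
  refine ⟨ε', 2 * (8 * max C₅ 0 + Ct), x₀, hε'0,
    fun x hx M N Q R hMN hN1 hN2 hQ hR _hQR hthr M₁ M₂ β γ δ hγ hδ => ?_⟩
  obtain ⟨hx3, hx₅, hy₀, hx4, hxa, hLc⟩ := hx₀ x hx
  -- basic facts
  have hx0 : 0 < x := by linarith
  have hx1 : 1 < x := by linarith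
  set L : ℝ := Real.log x with hLdef
  have hL0 : 0 < L := Real.log_pos hx1
  have hε2 : ε ≤ 1 / 2 := eps_le_half hx1 hN1 hN2
  have hxε : 0 < x ^ ε := Real.rpow_pos_of_pos hx0 ε
  have hN0 : 0 < N := hxε.trans_le hN1
  have hN1' : 1 ≤ N := le_trans (Real.one_le_rpow hx1.le hε.le) hN1
  have hTQ : Q ≤ thm5Threshold x Q R := le_trans (le_max_left _ _) (le_max_left _ _)
  have hM0 : 0 < M := by
    refine lt_of_le_of_lt (mul_nonneg hxε.le (le_trans (by linarith) hTQ)) hthr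
  obtain ⟨-, hQx, hRx⟩ := QR_lt_of_thm5Threshold hx1 hMN hN1 hQ (by linarith) hthr
  have hsqrt : N ^ (1 / 2 : ℝ) * M = x ^ (1 / 2 : ℝ) * M ^ (1 / 2 : ℝ) := by
    have hM12 : M ^ (1 / 2 : ℝ) * M ^ (1 / 2 : ℝ) = M := by rw [← Real.rpow_add hM0]; norm_num
    calc N ^ (1 / 2 : ℝ) * M = N ^ (1 / 2 : ℝ) * (M ^ (1 / 2 : ℝ) * M ^ (1 / 2 : ℝ)) := by rw [hM12]
      _ = (N * M) ^ (1 / 2 : ℝ) * M ^ (1 / 2 : ℝ) := by rw [Real.mul_rpow hN0.le hM0.le]; ring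
      _ = x ^ (1 / 2 : ℝ) * M ^ (1 / 2 : ℝ) := by rw [mul_comm N M, hMN]
  -- the depth `k`: `x^{ε/24} < 2^k ≤ 2 x^{ε/24}`
  set T : ℝ := x ^ (ε / 24) with hTdef
  have hT1 : 1 ≤ T := Real.one_le_rpow hx1.le (by positivity)
  obtain ⟨k, hk1, hk2⟩ := exists_pow_two_near hT1
  have h2k0 : (0 : ℝ) < 2 ^ k := by positivity
  have hT2 : 2 * T ≤ x ^ (ε / 6) := by
    -- `2T = 2 x^{ε/24} ≤ x^{ε/8} x^{ε/24} = x^{ε/6}`, as `2 ≤ 2|a| + 2 ≤ x^{ε/24} ≤ x^{ε/8}`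
    have h2 : (2 : ℝ) ≤ x ^ (ε / 8) := by
      have : (2 : ℝ) ≤ x ^ (ε / 24) := by linarith [abs_nonneg (a : ℝ)]
      exact this.trans (Real.rpow_le_rpow_of_exponent_le hx1.le (by linarith))
    calc 2 * T ≤ x ^ (ε / 8) * x ^ (ε / 24) := mul_le_mul_of_nonneg_right h2 (by positivity)
      _ = x ^ (ε / 6) := by rw [← Real.rpow_add hx0]; ring_nf
  have h2k6 : (2 : ℝ) ^ k ≤ x ^ (ε / 6) := hk2.trans hT2
  have h2k3 : ((2 : ℝ) ^ k) ^ 3 ≤ x ^ (ε / 2) := by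
    calc ((2 : ℝ) ^ k) ^ 3 ≤ (x ^ (ε / 6)) ^ 3 := pow_le_pow_left₀ h2k0.le h2k6 3
      _ = x ^ (ε / 2) := by rw [← Real.rpow_natCast, ← Real.rpow_mul hx0.le]; ring_nf
  have h2k : (2 : ℝ) ^ k ≤ x ^ (ε / 2) := le_trans (le_self_pow₀ (one_le_pow₀ (by norm_num)) (by norm_num)) h2k3
  have hx2k : x ^ (1 - ε / 2) ≤ x / 2 ^ k := by
    rw [Real.rpow_sub hx0, Real.rpow_one]
    exact div_le_div_of_nonneg_left hx0.le h2k0 h2k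
  have hxhalf : x ^ (1 / 2 : ℝ) ≤ x ^ (1 - ε / 2) := Real.rpow_le_rpow_of_exponent_le hx1.le (by linarith)
  -- `u = M/2^k ≥ |a| + 1`
  have hu1 : (|a| : ℝ) + 1 ≤ M / 2 ^ k := by
    rw [le_div_iff₀ h2k0]
    have h1 : x ^ ε * Q < M := lt_of_le_of_lt (mul_le_mul_of_nonneg_left hTQ hxε.le) hthr
    have h2 : x ^ (ε / 24) * x ^ (ε / 2) ≤ x ^ ε := by
      rw [← Real.rpow_add hx0]; exact Real.rpow_le_rpow_of_exponent_le hx1.le (by linarith)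
    nlinarith [mul_le_mul hxa h2k h2k0.le (Real.rpow_nonneg hx0.le _)]
  -- the clamp and the box function
  have hone : (fun m : ℕ => if M₁ < (m : ℝ) ∧ (m : ℝ) ≤ M₂ then (1 : ℝ) else 0) =
      fun m : ℕ => if M₁ < (m : ℝ) ∧ (m : ℝ) ≤ M₂ then roughIndicator 0 m else 0 := by
    funext m; rw [roughIndicator_of_le_two (by norm_num)]
  rw [hone, dispD_box_clamp a hM0.le]
  obtain ⟨hMu, huv, hv⟩ := clamp_bounds hM0.le M₁ M₂
  set u₀ : ℝ := max M (min M₁ (2 * M)) with hu₀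
  set v₀ : ℝ := max u₀ (min M₂ (2 * M)) with hv₀
  rw [dispD_box_eq_boxSum a hM0.le hMu huv hv]
  obtain ⟨g, hg⟩ : ∃ g : ℕ → ℝ, g = fun m => roughIndicator 0 m * rowF a N Q R β γ δ m := ⟨_, rfl⟩
  rw [← hg]
  have hγ' := abs_le_sigma_pow_ceil hB hγ
  have hδ' := abs_le_sigma_pow_ceil hB hδ
  -- the main quantity
  set W : ℝ := Real.sqrt (l2Sq N β) * x ^ (1 / 2 - ε') * M ^ (1 / 2 : ℝ) with hWdef
  have hW0 : 0 ≤ W := by positivity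
  set c₀ : ℝ := max C₅ 0 * W with hc₀
  have hc₀0 : 0 ≤ c₀ := by positivity
  -- (1) the dyadic pieces, from Theorem 5 at the scale `x/t`
  have hpiece : ∀ (j : ℕ) (M'' : ℝ), j < k → M / 2 ^ (j + 1) ≤ M'' → M'' ≤ M / 2 ^ j →
      |dispD a M'' N Q R (roughIndicator 0) β γ δ| ≤ c₀ * (((2 : ℝ) ^ (1 / 2 : ℝ))⁻¹) ^ j := by
    intro j M'' hjk hM''1 hM''2
    have h2j : (0 : ℝ) < 2 ^ j := by positivity
    have hM''0 : 0 < M'' := lt_of_lt_of_le (by positivity) hM''1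
    set t : ℝ := M / M'' with htdef
    have ht0 : 0 < t := div_pos hM0 hM''0
    have htj : (2 : ℝ) ^ j ≤ t := by
      rw [htdef, le_div_iff₀ hM''0]
      calc (2 : ℝ) ^ j * M'' ≤ 2 ^ j * (M / 2 ^ j) := mul_le_mul_of_nonneg_left hM''2 h2j.le
        _ = M := by field_simp
    have htj1 : t ≤ 2 ^ (j + 1) := by
      rw [htdef, div_le_iff₀ hM''0]
      calc M = 2 ^ (j + 1) * (M / 2 ^ (j + 1)) := by field_simp
        _ ≤ 2 ^ (j + 1) * M'' := mul_le_mul_of_nonneg_left hM''1 (by positivity)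
    have ht1 : 1 ≤ t := le_trans (one_le_pow₀ (by norm_num)) htj
    have htk : t ≤ 2 ^ k := htj1.trans (pow_le_pow_right₀ (by norm_num) hjk)
    have ht3 : t ^ 3 ≤ x ^ (ε / 2) := le_trans (pow_le_pow_left₀ ht0.le htk 3) h2k3
    obtain ⟨hMN'', hN1'', hN2'', hQR'', hthr''⟩ := thm5_hyp_at_scale hx1 hε hMN hN1 hN2 hQ hR hthr ht1 ht3
    have hMt : M / t = M'' := by rw [htdef]; field_simp
    have hxtk : x / 2 ^ k ≤ x / t := div_le_div_of_nonneg_left hx0.le ht0 htk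
    have hxt12 : x ^ (1 / 2 : ℝ) ≤ x / t := hxhalf.trans (hx2k.trans hxtk)
    have hxt0 : 0 < x / t := div_pos hx0 ht0
    have hxt1 : 1 ≤ x / t := le_trans (Real.one_le_rpow hx1.le (by norm_num)) hxt12
    have hx₅' : x₅ ≤ x / t := le_trans (le_max_left _ _) (hx₅.trans hxt12)
    have h := h5' (x / t) hx₅' (M / t) N Q R hMN'' hN1'' hN2'' hQ hR hQR'' hthr'' β γ δ hγ hδ
    rw [← BFI.roughIndicator_zero_eq_one] at h
    rw [← hMt]
    refine h.trans ?_
    -- `(x/t)^{1/2-ε₅} (M/t)^{1/2} ≤ x^{1/2-ε'} M^{1/2} / (t^{1/2-ε'} t^{1/2}) ≤ W (2^{1/2})^{-j}`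
    have hS0 : 0 ≤ Real.sqrt (l2Sq N β) * (x / t) ^ (1 / 2 - ε₅) * (M / t) ^ (1 / 2 : ℝ) := by positivity
    have hxt' : (x / t) ^ (1 / 2 - ε₅) ≤ x ^ (1 / 2 - ε') / t ^ (1 / 2 - ε') := by
      rw [← Real.div_rpow hx0.le ht0.le]
      exact Real.rpow_le_rpow_of_exponent_le hxt1 (by linarith)
    have hMt' : (M / t) ^ (1 / 2 : ℝ) = M ^ (1 / 2 : ℝ) / t ^ (1 / 2 : ℝ) := Real.div_rpow hM0.le ht0.le _
    have hden : ((2 : ℝ) ^ (1 / 2 : ℝ)) ^ j ≤ t ^ (1 / 2 - ε') * t ^ (1 / 2 : ℝ) := by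
      rw [← Real.rpow_add ht0]
      calc ((2 : ℝ) ^ (1 / 2 : ℝ)) ^ j = ((2 : ℝ) ^ j) ^ (1 / 2 : ℝ) := by
            rw [← Real.rpow_natCast ((2 : ℝ) ^ (1 / 2 : ℝ)) j, ← Real.rpow_mul (by norm_num),
              mul_comm, Real.rpow_mul (by norm_num), Real.rpow_natCast]
        _ ≤ t ^ (1 / 2 : ℝ) := Real.rpow_le_rpow (by positivity) htj (by norm_num)
        _ ≤ t ^ (1 / 2 - ε' + 1 / 2) := Real.rpow_le_rpow_of_exponent_le ht1 (by linarith)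
    have hr0 : (0 : ℝ) < ((2 : ℝ) ^ (1 / 2 : ℝ)) ^ j := by positivity
    calc C₅ * Real.sqrt (l2Sq N β) * (x / t) ^ (1 / 2 - ε₅) * (M / t) ^ (1 / 2 : ℝ)
        = C₅ * (Real.sqrt (l2Sq N β) * (x / t) ^ (1 / 2 - ε₅) * (M / t) ^ (1 / 2 : ℝ)) := by ring
      _ ≤ max C₅ 0 * (Real.sqrt (l2Sq N β) * (x / t) ^ (1 / 2 - ε₅) * (M / t) ^ (1 / 2 : ℝ)) :=
          mul_le_mul_of_nonneg_right (le_max_left _ _) hS0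
      _ ≤ max C₅ 0 * (Real.sqrt (l2Sq N β) * (x ^ (1 / 2 - ε') / t ^ (1 / 2 - ε')) *
            (M ^ (1 / 2 : ℝ) / t ^ (1 / 2 : ℝ))) := by
          rw [hMt']
          exact mul_le_mul_of_nonneg_left (mul_le_mul_of_nonneg_right
            (mul_le_mul_of_nonneg_left hxt' (Real.sqrt_nonneg _)) (by positivity)) (le_max_right _ _)
      _ = max C₅ 0 * W / (t ^ (1 / 2 - ε') * t ^ (1 / 2 : ℝ)) := by
          rw [hWdef]; field_simp
      _ ≤ max C₅ 0 * W / ((2 : ℝ) ^ (1 / 2 : ℝ)) ^ j :=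
          div_le_div_of_nonneg_left (by positivity) hr0 hden
      _ = c₀ * (((2 : ℝ) ^ (1 / 2 : ℝ))⁻¹) ^ j := by rw [hc₀, inv_pow, div_eq_mul_inv]
  -- (2) one `P`-box `(M, P]`, `M ≤ P ≤ 2M`
  have hPbox : ∀ P : ℝ, M ≤ P → P ≤ 2 * M → |boxSum g M P| ≤ (8 * max C₅ 0 + Ct) * W := by
    intro P hMP hP2
    have hP0 : 0 < P := hM0.trans_le hMP
    rw [boxSum_telescope g hM0.le hMP hP2 k]
    -- the dyadic pieces: `∑_j 2 c₀ (2^{-1/2})^j ≤ 2 c₀ ∑_j (3/4)^j ≤ 8 c₀`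
    have hr : ((2 : ℝ) ^ (1 / 2 : ℝ))⁻¹ ≤ 3 / 4 := by
      rw [inv_le_comm₀ (by positivity) (by norm_num)]
      -- `4/3 ≤ √2` as `(4/3)² = 16/9 ≤ 2`
      rw [← Real.sqrt_eq_rpow]
      refine Real.le_sqrt_of_sq_le ?_
      norm_num
    have hdy : |∑ j ∈ Finset.range k,
        (boxSum g (P / 2 ^ (j + 1)) (P / 2 ^ j) - boxSum g (M / 2 ^ (j + 1)) (M / 2 ^ j))| ≤ 8 * c₀ := by
      have hterm : ∀ j ∈ Finset.range k,
          |boxSum g (P / 2 ^ (j + 1)) (P / 2 ^ j) - boxSum g (M / 2 ^ (j + 1)) (M / 2 ^ j)| ≤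
            2 * c₀ * (3 / 4 : ℝ) ^ j := by
        intro j hj
        rw [Finset.mem_range] at hj
        have e2 : ∀ Y : ℝ, Y / 2 ^ j = 2 * (Y / 2 ^ (j + 1)) := fun Y => by
          rw [pow_succ]; field_simp
        have eP : boxSum g (P / 2 ^ (j + 1)) (P / 2 ^ j) =
            dispD a (P / 2 ^ (j + 1)) N Q R (roughIndicator 0) β γ δ := by
          rw [e2 P, dispD_rough_eq_boxSum a (by positivity), hg]
        have eM : boxSum g (M / 2 ^ (j + 1)) (M / 2 ^ j) =
            dispD a (M / 2 ^ (j + 1)) N Q R (roughIndicator 0) β γ δ := by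
          rw [e2 M, dispD_rough_eq_boxSum a (by positivity), hg]
        have hP1 : P / 2 ^ (j + 1) ≤ M / 2 ^ j :=
          calc P / 2 ^ (j + 1) = (P / 2) / 2 ^ j := by rw [pow_succ]; ring
            _ ≤ M / 2 ^ j := div_le_div_of_nonneg_right (by linarith) (by positivity)
        have h1 := hpiece j (P / 2 ^ (j + 1)) hj (div_le_div_of_nonneg_right hMP (by positivity)) hP1
        have hM1 : M / 2 ^ (j + 1) ≤ M / 2 ^ j :=
          calc M / 2 ^ (j + 1) = (M / 2) / 2 ^ j := by rw [pow_succ]; ring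
            _ ≤ M / 2 ^ j := div_le_div_of_nonneg_right (by linarith) (by positivity)
        have h2 := hpiece j (M / 2 ^ (j + 1)) hj le_rfl hM1
        have hgeom : c₀ * (((2 : ℝ) ^ (1 / 2 : ℝ))⁻¹) ^ j ≤ c₀ * (3 / 4 : ℝ) ^ j :=
          mul_le_mul_of_nonneg_left (pow_le_pow_left₀ (by positivity) hr j) hc₀0
        rw [eP, eM]
        calc |dispD a (P / 2 ^ (j + 1)) N Q R (roughIndicator 0) β γ δ -
              dispD a (M / 2 ^ (j + 1)) N Q R (roughIndicator 0) β γ δ|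
            ≤ |dispD a (P / 2 ^ (j + 1)) N Q R (roughIndicator 0) β γ δ| +
              |dispD a (M / 2 ^ (j + 1)) N Q R (roughIndicator 0) β γ δ| := abs_sub _ _
          _ ≤ c₀ * (3 / 4 : ℝ) ^ j + c₀ * (3 / 4 : ℝ) ^ j := add_le_add (h1.trans hgeom) (h2.trans hgeom)
          _ = 2 * c₀ * (3 / 4) ^ j := by ring
      have hgs : ∑ j ∈ Finset.range k, (3 / 4 : ℝ) ^ j ≤ 4 := by
        have h := geom_sum_Ico_le_of_lt_one (show (0 : ℝ) ≤ 3 / 4 by norm_num)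
          (show (3 / 4 : ℝ) < 1 by norm_num) (m := 0) (n := k)
        rw [Finset.range_eq_Ico]
        refine h.trans ?_
        norm_num
      calc |∑ j ∈ Finset.range k,
            (boxSum g (P / 2 ^ (j + 1)) (P / 2 ^ j) - boxSum g (M / 2 ^ (j + 1)) (M / 2 ^ j))|
          ≤ ∑ j ∈ Finset.range k,
            |boxSum g (P / 2 ^ (j + 1)) (P / 2 ^ j) - boxSum g (M / 2 ^ (j + 1)) (M / 2 ^ j)| :=
            Finset.abs_sum_le_sum_abs _ _
        _ ≤ ∑ j ∈ Finset.range k, 2 * c₀ * (3 / 4 : ℝ) ^ j := Finset.sum_le_sum hterm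
        _ = 2 * c₀ * ∑ j ∈ Finset.range k, (3 / 4 : ℝ) ^ j := by rw [Finset.mul_sum]
        _ ≤ 2 * c₀ * 4 := mul_le_mul_of_nonneg_left hgs (by positivity)
        _ = 8 * c₀ := by ring
    -- the remainder box at scale `M/2^k`, bounded trivially
    have hrem : |boxSum g (M / 2 ^ k) (P / 2 ^ k)| ≤ Ct * W := by
      set u : ℝ := M / 2 ^ k with hudef
      have hu1' : 1 ≤ u := le_trans (by linarith [abs_nonneg (a : ℝ)]) hu1
      have hau : (|a| : ℝ) < u := lt_of_lt_of_le (by linarith) hu1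
      have huv' : u ≤ P / 2 ^ k := div_le_div_of_nonneg_right hMP h2k0.le
      have hvu' : P / 2 ^ k ≤ 2 * u := by
        rw [hudef, mul_div_assoc']
        exact div_le_div_of_nonneg_right hP2 h2k0.le
      have huN : u * N = x / 2 ^ k := by rw [hudef, ← hMN]; ring
      have huNx : u * N ≤ x := by rw [huN]; exact div_le_self hx0.le (one_le_pow₀ (by norm_num))
      have h4uN : x ^ (1 - ε / 2) ≤ 4 * u * N := by
        rw [mul_assoc, huN]
        exact hx2k.trans (by linarith [div_pos hx0 h2k0])
      have hy : y₀ ≤ 4 * u * N :=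
        le_trans (le_max_left _ _) (hy₀.trans (hxhalf.trans h4uN))
      have hNy : 2 * N ≤ (4 * u * N) ^ (1 - ε / 4) := by
        calc 2 * N ≤ x ^ (ε / 4) * x ^ (1 - ε) := mul_le_mul hx4 hN2 hN0.le (by positivity)
          _ = x ^ (1 - 3 * ε / 4) := by rw [← Real.rpow_add hx0]; ring_nf
          _ ≤ x ^ ((1 - ε / 2) * (1 - ε / 4)) := Real.rpow_le_rpow_of_exponent_le hx1.le (by nlinarith)
          _ = (x ^ (1 - ε / 2)) ^ (1 - ε / 4) := by rw [Real.rpow_mul hx0.le]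
          _ ≤ (4 * u * N) ^ (1 - ε / 4) := Real.rpow_le_rpow (by positivity) h4uN (by linarith)
      have hQx2 : Q ≤ x ^ 2 := by
        have : x ^ (1 - 2 * ε) ≤ x := by
          calc x ^ (1 - 2 * ε) ≤ x ^ (1 : ℝ) := Real.rpow_le_rpow_of_exponent_le hx1.le (by linarith)
            _ = x := Real.rpow_one x
        nlinarith
      have hRx2 : R ≤ x ^ 2 := by
        have : x ^ (1 - 2 * ε) ≤ x := by
          calc x ^ (1 - 2 * ε) ≤ x ^ (1 : ℝ) := Real.rpow_le_rpow_of_exponent_le hx1.le (by linarith)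
            _ = x := Real.rpow_one x
        nlinarith
      have h := ht x u (P / 2 ^ k) N Q R (roughIndicator 0) β γ δ hx3 hy hu1' huv' hvu' hN1' huNx hau
        hNy (by linarith) hQx2 (by linarith) hRx2 (abs_roughIndicator_le_one 0) hγ' hδ'
      rw [hg]
      refine h.trans ?_
      -- `Ct ‖β‖ N^{1/2} (M/2^k) L^c ≤ Ct ‖β‖ x^{1/2-ε'} M^{1/2}` as `2^k > x^{ε/24} ≥ x^{ε'} L^c`
      have hkey : L ^ c / 2 ^ k ≤ x ^ (-ε') := by
        rw [div_le_iff₀ h2k0]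
        have h1 : L ^ c ≤ x ^ (ε / 48) := hLc
        have h2 : x ^ (ε / 48) ≤ x ^ (-ε') * T := by
          rw [hTdef, ← Real.rpow_add hx0]
          exact Real.rpow_le_rpow_of_exponent_le hx1.le (by linarith)
        calc L ^ c ≤ x ^ (-ε') * T := h1.trans h2
          _ ≤ x ^ (-ε') * 2 ^ k := mul_le_mul_of_nonneg_left hk1.le (by positivity)
      have hxsplit : x ^ (1 / 2 : ℝ) * x ^ (-ε') = x ^ (1 / 2 - ε') := by
        rw [← Real.rpow_add hx0]; ring_nf
      calc Ct * Real.sqrt (l2Sq N β) * N ^ (1 / 2 : ℝ) * u * L ^ c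
          = Ct * Real.sqrt (l2Sq N β) * (N ^ (1 / 2 : ℝ) * M) * (L ^ c / 2 ^ k) := by
            rw [hudef]; ring
        _ ≤ Ct * Real.sqrt (l2Sq N β) * (N ^ (1 / 2 : ℝ) * M) * x ^ (-ε') :=
            mul_le_mul_of_nonneg_left hkey (by positivity)
        _ = Ct * W := by
            rw [hsqrt, hWdef, ← hxsplit]; ring
    calc |(∑ j ∈ Finset.range k,
          (boxSum g (P / 2 ^ (j + 1)) (P / 2 ^ j) - boxSum g (M / 2 ^ (j + 1)) (M / 2 ^ j))) +
          boxSum g (M / 2 ^ k) (P / 2 ^ k)|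
        ≤ |∑ j ∈ Finset.range k,
          (boxSum g (P / 2 ^ (j + 1)) (P / 2 ^ j) - boxSum g (M / 2 ^ (j + 1)) (M / 2 ^ j))| +
          |boxSum g (M / 2 ^ k) (P / 2 ^ k)| := abs_add_le _ _
      _ ≤ 8 * c₀ + Ct * W := add_le_add hdy hrem
      _ = (8 * max C₅ 0 + Ct) * W := by rw [hc₀]; ring
  -- (3) conclusion
  have hsplit : boxSum g u₀ v₀ = boxSum g M v₀ - boxSum g M u₀ := by
    have := boxSum_add g hMu huv; linarith
  rw [hsplit]
  calc |boxSum g M v₀ - boxSum g M u₀| ≤ |boxSum g M v₀| + |boxSum g M u₀| := abs_sub _ _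
    _ ≤ (8 * max C₅ 0 + Ct) * W + (8 * max C₅ 0 + Ct) * W :=
        add_le_add (hPbox v₀ (hMu.trans huv) hv) (hPbox u₀ hMu (huv.trans hv))
    _ = 2 * (8 * max C₅ 0 + Ct) * Real.sqrt (l2Sq N β) * x ^ (1 / 2 - ε') * M ^ (1 / 2 : ℝ) := by
        rw [hWdef]; ring

end Literature.NumberTheory.Sieve
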